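import Literature.RepresentationTheory.KonnoKonno2007.JunctionVacuumOverlap
import Literature.RepresentationTheory.KonnoKonno2007.JunctionLinearWeilDatum
import Mathlib.Analysis.SpecificLimits.Normed
import HarnessLib

/-!
# The vacuum-overlap phase identity `(★★)_{-|R|}` for every finite `R` (`S = ∅`, `|Q| = 1`): the radial ladder, and the
# unconditional linearised Weil datum on the slots `U(P,Q) × U(|R|)`

Literature reproduction (kernel, `[folklore]` / `[cite: Folland1989]` for the Fock-model conventions §1.6–§1.7, §4.2
Prop. (4.39)).  The DISCHARGE of the hypothesis `hVV : VacuumOverlapPhase R S p₀ q₀ m` of `JunctionLinearWeilDatum`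
(`isArchWeilDatum_linWeil`, `isArchWeilDatum_linWeil_of_isEmpty_right`) for EVERY nonempty finite `R`, `S = ∅`,
`|Q| = 1`, with the exponent `m = -|R|` — in particular the `dim W_k = 2` slots (`|R| = 2`, `m = -2`), which the
single-mode leaf `JunctionVacuumOverlapPhaseOne` (`|R| = 1`) does not reach.

Mechanism (the RADIAL LADDER; `m := |R|`).  Put `Q := Σ_r z_{(p₀,r)} z_{(q₀,r)}` (`radQ`), the `K`-bi-invariant
quadratic generator of the hyperbolic family at the base point, and for `c : P → ℂ` the pencil
`L_c := Σ_p c_p Σ_r z_{(p,r)} z_{(q₀,r)}` (`radPencil`).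
* §1–§2 (polynomial algebra in the Fock model): the pair symbol closes on the chain `Q^N`,
  `Σ_r hypPairSymb (Q^N) = π Q^{N+1} + π⁻¹ N (N+m-1) Q^{N-1}` (`sum_hypPairSymb_radQ_pow`), and the pencil Gram formula
  `⟪Q^M, L_c^N⟫_𝓕 = δ_{MN} c_{p₀}^N w_N`, `w_{N+1} = w_N (N+1)(N+m)/π²` (`inner_fockToL2_radQ_pow_radPencil_pow`), both by
  the radial Laplacian `Δ = Σ_r ∂_{(p₀,r)} ∂_{(q₀,r)}` and `Δ L_c^{N+1} = (N+1)(N+m) c_{p₀} L_c^N · (c_{p₀}-direction)`.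
* §3–§7 (analysis along the family): the radial coefficients `a_N(s) := ⟪B⁻¹Q^N, hypOp s h₀⟫_{L²}` satisfy the closed
  ODE `a_N' = -i (π a_{N+1} + π⁻¹ N (N+m-1) a_{N-1})` (`hasDerivAt_radCoeff`), i.e. for `A_N := λ_N i^N a_N` (`radA`,
  `λ_{N+1} = λ_N π/(N+m)`): `A_N' = N A_{N-1} - (N+m) A_{N+1}`, `A_N(0) = δ_{N0}` (`hasDerivAt_radA`); Bessel over the orthonormal radial vectors gives `Σ_N C(N+m-1,N) |A_N|² ≤ 1`, the energy identity
  `Σ_N C(N+m-1,N) B_N A_N ≡ 1` with the candidate `B_N := sech^m s tanh^N s` (`tsum_radU_eq_one`) and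
  `Σ_N C(N+m-1,N) B_N² = 1` (negative-binomial series) force `A_N = B_N` (`radA_eq_radB`), i.e.
  `a_N(s) = (-i)^N λ_N⁻¹ sech^m s tanh^N s` (`radCoeff_eq`), and equality in Bessel: the squeezed vacuum `hypOp s h₀`
  expands in `L²` along the normalised radial chain (`hasSum_inner_radOn_smul_radOn`, §8).
* §9 (K-b′): for a block datum `k = ((a,b),(c,d)) ∈ K`, `Q ∘ ι(k)⋆ = a-pencil`, precisely
  `linSubst (star ι(k)) Q = L_{p' ↦ a_{p'p₀} b̄_{q₀q₀}}` (`linSubst_star_dualPairι_radQ`; the `U(R)` letter `c` drops out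
  by `c c⋆ = 1`), whence `⟪Q̂_M, μ₀(ι k) Q̂_N⟫ = δ_{MN} (a_{p₀p₀} b̄_{q₀q₀})^N` on the normalised chain
  (`inner_radOn_schrodingerU_radOn`).
* §10 (K-c′): summing the series, `V(t,k,s) := vacCoeffS (hypOp t ∘ μ₀(ι k) ∘ hypOp s)
  = sech^m t sech^m s · (1 + a_{p₀p₀} b̄_{q₀q₀} tanh t tanh s)^{-m}` (`vacCoeffS_hypOp_comp_dualPairι_comp_hypOp_card`,
  via `hasSum_choose_mul_geometric_of_norm_lt_one`); for `m = 1` this is `JunctionVacuumOverlap`'s formula.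
* §11 (sockets): `VacuumOverlapPhase R S p₀ q₀ (-|R|)` through the producer socket
  `vacuumOverlapPhase_neg_natCast_of_exists_pos` + `χ_eq_mul_conj`, and the unconditional datum through
  `isArchWeilDatum_linWeil_of_isEmpty_right`.

## Main results

* `sum_hypPairSymb_radQ_pow`, `inner_fockToL2_radQ_pow_radPencil_pow` — the closed radial chain and its Gram formula;
* `radCoeff_eq`, `hasSum_inner_radOn_smul_radOn` — the squeezed-vacuum coefficients along the chain and the `L²`
  expansion of `hypOp s h₀` along it;
* `linSubst_star_dualPairι_radQ`, `inner_radOn_schrodingerU_radOn` — (K-b′) the block datum is diagonal on the chain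
  with eigenvalues `(a_{p₀p₀} b̄_{q₀q₀})^N`;
* `vacCoeffS_hypOp_comp_dualPairι_comp_hypOp_card` — (K-c′) the closed form of the three-letter vacuum overlap;
* `vacuumOverlapPhase_neg_card` — `VacuumOverlapPhase R S p₀ q₀ (-(Fintype.card R : ℤ))` for
  `[Nonempty R] [IsEmpty S] [Subsingleton Q]`;
* `isArchWeilDatum_linWeil_neg_card` — the linearised section `linWeil R S q₀ (-|R|)` IS an archimedean Weil datum of
  `U(P,Q) × U(R,S)` (`S = ∅`, `|Q| = 1`, any nonempty finite `R`), unconditionally, with vacuum character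
  `vacScalar ⟨0, -|R|, 0, 0⟩` on `K`.

BOUNDARY: no records, no `def … : Prop`, no cited hypothesis; every `[cite]` tag is provenance of a convention, every
statement is proved from the imports; `FockVacuumCharacter*` is not referenced.  `JunctionVacuumOverlapPhaseOne`
(`|R| = 1`) stays as the landed special case.

## References

* [Folland1989] G. B. Folland, Harmonic analysis in phase space, Annals of Math. Studies 122 (1989) — §1.6 (1.63), (1.68),
  §1.7 (1.77), (1.82), §4.2 (4.24), Prop. (4.39) (Fock model, metaplectic conventions).
* [KonnoKonno2007] K. Konno, T. Konno, Kyushu J. Math. 61 (2007) — §3.1 (the dual pair; conventions only).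
-/

set_option autoImplicit false

noncomputable section

open Matrix Complex MeasureTheory Filter MvPolynomial
open scoped Topology Real InnerProductSpace ComplexConjugate BigOperators

namespace Literature.RepresentationTheory.KonnoKonno2007

namespace RealDualPair

open Literature.Analysis.SegalBargmann

local notation "SR" σ => SchwartzMap (σ → ℝ) ℂ
local notation "L2R" σ => Lp ℂ 2 (volume : Measure (σ → ℝ))

/-! ## §0  Real prelude: the weights `w_N`, `λ_N`, `C_N` and the candidate `B_N = sech^m tanh^N` (generic `m`) -/

section RadialReal

/-- **the radial Fock weights** `w_N = ‖Q^N‖²_𝓕`: `w_0 = 1`, `w_{N+1} = w_N (N+1)(N+m)/π²`. [cite: Folland1989, Thm (1.63)] -/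
def radW (m : ℕ) : ℕ → ℝ
  | 0 => 1
  | N + 1 => radW m N * (((N : ℝ) + 1) * ((N : ℝ) + m) / Real.pi ^ 2)

/-- `0 < w_N` (`m ≥ 1`). [folklore] -/
theorem radW_pos {m : ℕ} (hm : 0 < m) (N : ℕ) : 0 < radW m N := by
  induction N with
  | zero => exact zero_lt_one
  | succ N ih =>
    rw [radW]
    have : (0 : ℝ) < m := Nat.cast_pos.mpr hm
    positivity

/-- **the normalising factors** `λ_0 = 1`, `λ_{N+1} = λ_N π/(N+m)` (so `A_N := i^N λ_N a_N` obeys the candidate's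
recursion). [folklore] -/
def radLam (m : ℕ) : ℕ → ℝ
  | 0 => 1
  | N + 1 => radLam m N * (Real.pi / ((N : ℝ) + m))

/-- `0 < λ_N` (`m ≥ 1`). [folklore] -/
theorem radLam_pos {m : ℕ} (hm : 0 < m) (N : ℕ) : 0 < radLam m N := by
  induction N with
  | zero => exact zero_lt_one
  | succ N ih =>
    rw [radLam]
    have : (0 : ℝ) < m := Nat.cast_pos.mpr hm
    positivity

/-- **the pairing weights** `C_0 = 1`, `C_{N+1} = C_N (N+m)/(N+1)` (`= binom(N+m−1, N)`). [folklore] -/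
def radC (m : ℕ) : ℕ → ℝ
  | 0 => 1
  | N + 1 => radC m N * (((N : ℝ) + m) / ((N : ℝ) + 1))

/-- `C_{N+1} (N+1) = C_N (N+m)`. [folklore] -/
theorem radC_succ_mul (m N : ℕ) : radC m (N + 1) * ((N : ℝ) + 1) = radC m N * ((N : ℝ) + m) := by
  rw [radC]
  have : (N : ℝ) + 1 ≠ 0 := by positivity
  field_simp

/-- `C_N = binom(N+k, k)` for `m = k+1`. [folklore] -/
theorem radC_eq_choose (k N : ℕ) : radC (k + 1) N = ((N + k).choose k : ℝ) := by
  induction N with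
  | zero => simp [radC]
  | succ N ih =>
    rw [radC, ih]
    have e := Nat.choose_mul_succ_eq (N + k) k
    rw [show N + k + 1 - k = N + 1 by omega, show N + k + 1 = N + 1 + k by omega] at e
    have e' : ((N + k).choose k : ℝ) * ((N : ℝ) + ((k + 1 : ℕ) : ℝ)) = ((N + 1 + k).choose k : ℝ) * ((N : ℝ) + 1) := by
      have := congrArg (fun n : ℕ => (n : ℝ)) e
      push_cast at this ⊢
      linear_combination this
    have hN : (N : ℝ) + 1 ≠ 0 := by positivity
    field_simp
    linear_combination e'

/-- `0 < C_N` (`m ≥ 1`). [folklore] -/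
theorem radC_pos {m : ℕ} (hm : 0 < m) (N : ℕ) : 0 < radC m N := by
  obtain ⟨k, rfl⟩ := Nat.exists_eq_succ_of_ne_zero hm.ne'
  rw [radC_eq_choose]
  exact Nat.cast_pos.mpr (Nat.choose_pos (Nat.le_add_left k N))

/-- `1 ≤ C_N` (`m ≥ 1`). [folklore] -/
theorem one_le_radC {m : ℕ} (hm : 0 < m) (N : ℕ) : 1 ≤ radC m N := by
  obtain ⟨k, rfl⟩ := Nat.exists_eq_succ_of_ne_zero hm.ne'
  rw [radC_eq_choose]
  exact_mod_cast Nat.choose_pos (Nat.le_add_left k N)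

/-- **the key normalisation identity** `C_N λ_N² w_N = 1`. [folklore] -/
theorem radC_mul_radLam_sq_mul_radW {m : ℕ} (hm : 0 < m) (N : ℕ) : radC m N * radLam m N ^ 2 * radW m N = 1 := by
  induction N with
  | zero => simp [radC, radLam, radW]
  | succ N ih =>
    have h0 : (0 : ℝ) < m := Nat.cast_pos.mpr hm
    have h1 : (N : ℝ) + m ≠ 0 := by positivity
    have h2 : (N : ℝ) + 1 ≠ 0 := by positivity
    have e : radC m (N + 1) * radLam m (N + 1) ^ 2 * radW m (N + 1) = (radC m N * radLam m N ^ 2 * radW m N) *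
        ((((N : ℝ) + m) / ((N : ℝ) + 1)) * (Real.pi / ((N : ℝ) + m)) ^ 2 *
          (((N : ℝ) + 1) * ((N : ℝ) + m) / Real.pi ^ 2)) := by
      simp only [radC, radLam, radW]
      ring
    rw [e, ih, one_mul]
    field_simp

/-- **the candidate** `B_N(s) := sech^m s · tanh^N s`. [folklore] -/
def radB (m N : ℕ) (s : ℝ) : ℝ := (Real.cosh s)⁻¹ ^ m * (Real.sinh s / Real.cosh s) ^ N

/-- `B_N' = N B_{N−1} − (N+m) B_{N+1}` (uses `sech² + tanh² = 1`). [folklore] -/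
theorem hasDerivAt_radB (m N : ℕ) (s : ℝ) :
    HasDerivAt (radB m N) ((N : ℝ) * radB m (N - 1) s - ((N : ℝ) + m) * radB m (N + 1) s) s := by
  have hc : Real.cosh s ≠ 0 := (Real.cosh_pos s).ne'
  have h1 : Real.cosh s * Real.cosh s - Real.sinh s * Real.sinh s = 1 := by
    rw [← sq, ← sq]; exact Real.cosh_sq_sub_sinh_sq s
  have hσ : HasDerivAt (fun y => (Real.cosh y)⁻¹) (-((Real.cosh s)⁻¹ * (Real.sinh s / Real.cosh s))) s := by
    refine ((Real.hasDerivAt_cosh s).fun_inv hc).congr_deriv ?_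
    ring
  have hτ : HasDerivAt (fun y => Real.sinh y / Real.cosh y) ((Real.cosh s)⁻¹ ^ 2) s := by
    refine ((Real.hasDerivAt_sinh s).fun_div (Real.hasDerivAt_cosh s) hc).congr_deriv ?_
    rw [h1, inv_pow, one_div]
  refine ((hσ.fun_pow m).fun_mul (hτ.fun_pow N)).congr_deriv ?_
  have key := sech_sq_add_tanh_sq s
  simp only [radB]
  rcases N with _ | N <;> rcases m with _ | m
  · simp
  · simp only [Nat.add_sub_cancel]
    push_cast
    ring
  · simp only [Nat.add_sub_cancel]
    push_cast
    linear_combination (((N : ℝ) + 1) * (Real.sinh s / Real.cosh s) ^ N) * key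
  · simp only [Nat.add_sub_cancel]
    push_cast
    linear_combination (((N : ℝ) + 1) * (Real.cosh s)⁻¹ ^ (m + 1) * (Real.sinh s / Real.cosh s) ^ N) * key

/-- initial value `B_N(0) = δ_{N0}`. [folklore] -/
theorem radB_zero_right (m N : ℕ) : radB m N 0 = if N = 0 then 1 else 0 := by
  rcases N with _ | N
  · simp [radB]
  · simp [radB, Real.sinh_zero]

/-- `|B_N(s)| ≤ |tanh s|^N`. [folklore] -/
theorem abs_radB_le (m N : ℕ) (s : ℝ) : |radB m N s| ≤ |Real.sinh s / Real.cosh s| ^ N := by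
  rw [radB, abs_mul, abs_pow, abs_pow, abs_inv, abs_of_pos (Real.cosh_pos s)]
  refine mul_le_of_le_one_left (pow_nonneg (abs_nonneg _) N) ?_
  exact pow_le_one₀ (inv_nonneg.mpr (Real.cosh_pos s).le) (inv_le_one_of_one_le₀ (Real.one_le_cosh s))

/-- `‖(B_N y : ℂ)‖ ≤ T^N` on `{|tanh| ≤ T}`. [folklore] -/
theorem norm_ofReal_radB_le {T y : ℝ} (hT : |Real.sinh y / Real.cosh y| ≤ T) (m N : ℕ) :
    ‖(radB m N y : ℂ)‖ ≤ T ^ N := by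
  rw [Complex.norm_real, Real.norm_eq_abs]
  exact (abs_radB_le m N y).trans (pow_le_pow_left₀ (abs_nonneg _) hT N)

/-- **`Σ_N binom(N+k,k) B_N(s)² = 1`** (`m = k+1`; the negative-binomial series at `tanh²`). [folklore] -/
theorem hasSum_choose_mul_radB_sq (k : ℕ) (s : ℝ) :
    HasSum (fun N : ℕ => ((N + k).choose k : ℝ) * radB (k + 1) N s ^ 2) 1 := by
  have ht : ‖(Real.sinh s / Real.cosh s) ^ 2‖ < 1 := by
    rw [norm_pow, Real.norm_eq_abs]
    exact pow_lt_one₀ (abs_nonneg _) (abs_tanh_lt_one s) two_ne_zero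
  have hg := hasSum_choose_mul_geometric_of_norm_lt_one k ht
  have key := sech_sq_add_tanh_sq s
  have h1 : (1 : ℝ) - (Real.sinh s / Real.cosh s) ^ 2 = (Real.cosh s)⁻¹ ^ 2 := by linarith
  rw [h1] at hg
  have hne : ((Real.cosh s)⁻¹ ^ 2) ^ (k + 1) ≠ 0 := pow_ne_zero _ (pow_ne_zero 2 (inv_ne_zero (Real.cosh_pos s).ne'))
  have h3 := hg.mul_left (((Real.cosh s)⁻¹ ^ 2) ^ (k + 1))
  rw [one_div, mul_inv_cancel₀ hne] at h3
  have hfun : (fun N : ℕ => ((N + k).choose k : ℝ) * radB (k + 1) N s ^ 2) =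
      fun N => ((Real.cosh s)⁻¹ ^ 2) ^ (k + 1) * (((N + k).choose k : ℝ) * ((Real.sinh s / Real.cosh s) ^ 2) ^ N) := by
    funext N
    rw [radB]
    ring
  rw [hfun]
  exact h3

/-- `Σ_N C_N B_N(s)² = 1` in the `radC` spelling (`m ≥ 1`). [folklore] -/
theorem hasSum_radC_mul_radB_sq {m : ℕ} (hm : 0 < m) (s : ℝ) :
    HasSum (fun N : ℕ => radC m N * radB m N s ^ 2) 1 := by
  obtain ⟨k, rfl⟩ := Nat.exists_eq_succ_of_ne_zero hm.ne'
  simpa only [radC_eq_choose] using hasSum_choose_mul_radB_sq k s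

/-- the majorant series `Σ_n (n+1) binom(n+1+k, k) T^n` converges for `0 ≤ T < 1`. [folklore] -/
theorem summable_succ_mul_choose_mul_pow (k : ℕ) {T : ℝ} (hT0 : 0 ≤ T) (hT1 : T < 1) :
    Summable fun n : ℕ => ((n : ℝ) + 1) * ((n + 1 + k).choose k : ℝ) * T ^ n := by
  have h := (summable_choose_mul_geometric_of_norm_lt_one (k + 1)
    (show ‖T‖ < 1 by rwa [Real.norm_eq_abs, abs_of_nonneg hT0])).mul_left ((k : ℝ) + 1)
  refine h.congr fun n => ?_
  have e := Nat.choose_succ_right_eq (n + k + 1) k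
  rw [show n + k + 1 - k = n + 1 by omega] at e
  have e' : ((n + (k + 1)).choose (k + 1) : ℝ) * ((k : ℝ) + 1) = ((n + 1 + k).choose k : ℝ) * ((n : ℝ) + 1) := by
    rw [show n + (k + 1) = n + k + 1 by omega, show n + 1 + k = n + k + 1 by omega]
    exact_mod_cast e
  linear_combination (T ^ n) * e'

/-- `Σ_N N C_N T^{N−1}` converges (`m ≥ 1`, `0 ≤ T < 1`). [folklore] -/
theorem summable_mul_radC_mul_pow {m : ℕ} (hm : 0 < m) {T : ℝ} (hT0 : 0 ≤ T) (hT1 : T < 1) :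
    Summable fun N : ℕ => (N : ℝ) * radC m N * T ^ (N - 1) := by
  obtain ⟨k, rfl⟩ := Nat.exists_eq_succ_of_ne_zero hm.ne'
  refine (summable_nat_add_iff 1).mp ((summable_succ_mul_choose_mul_pow k hT0 hT1).congr fun n => ?_)
  rw [radC_eq_choose, Nat.add_sub_cancel]
  push_cast
  ring

/-- `Σ_N C_N T^N` converges (`m ≥ 1`, `0 ≤ T < 1`). [folklore] -/
theorem summable_radC_mul_pow {m : ℕ} (hm : 0 < m) {T : ℝ} (hT0 : 0 ≤ T) (hT1 : T < 1) :
    Summable fun N : ℕ => radC m N * T ^ N := by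
  obtain ⟨k, rfl⟩ := Nat.exists_eq_succ_of_ne_zero hm.ne'
  refine (summable_choose_mul_geometric_of_norm_lt_one k
    (show ‖T‖ < 1 by rwa [Real.norm_eq_abs, abs_of_nonneg hT0])).congr fun n => ?_
  rw [radC_eq_choose]

end RadialReal

section Radial

variable {P Q : Type*} (R S : Type*)

/-! ## §1  The radial generator `Q = Σ_r z_{(p₀,r)} z_{(q₀,r)}`, the `P`-pencils, and the radial Laplacian -/

/-- `∂_{(q₀,r)} z_{(p,r')} = 0`. [folklore] -/
theorem pderiv_idxQ_X_idxP (q₀ : Q) (p : P) (r r' : R) :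
    pderiv (idxQ R S q₀ r) (X (idxP R S p r') : MvPolynomial (DPIdx P Q R S) ℂ) = 0 :=
  pderiv_X_of_ne (by simp [idxP, idxQ])

/-- `∂_{(p,r)} z_{(q₀,r')} = 0`. [folklore] -/
theorem pderiv_idxP_X_idxQ (q₀ : Q) (p : P) (r r' : R) :
    pderiv (idxP R S p r) (X (idxQ R S q₀ r') : MvPolynomial (DPIdx P Q R S) ℂ) = 0 :=
  pderiv_X_of_ne (by simp [idxP, idxQ])

/-- `∂_{(q₀,r)} z_{(q₀,r')} = δ_{rr'}`. [folklore] -/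
theorem pderiv_idxQ_X_idxQ [DecidableEq R] (q₀ : Q) (r r' : R) :
    pderiv (idxQ R S q₀ r) (X (idxQ R S q₀ r') : MvPolynomial (DPIdx P Q R S) ℂ) = if r' = r then 1 else 0 := by
  split_ifs with h
  · rw [h, pderiv_X_self]
  · exact pderiv_X_of_ne (by simpa [idxQ] using h)

/-- `∂_{(p,r)} z_{(p',r')} = δ_{pp'} δ_{rr'}`. [folklore] -/
theorem pderiv_idxP_X_idxP [DecidableEq P] [DecidableEq R] (p p' : P) (r r' : R) :
    pderiv (idxP R S p r) (X (idxP R S p' r') : MvPolynomial (DPIdx P Q R S) ℂ) =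
      if p' = p ∧ r' = r then 1 else 0 := by
  split_ifs with h
  · rw [h.1, h.2, pderiv_X_self]
  · exact pderiv_X_of_ne (by simpa [idxP] using h)

variable [Fintype R]

/-- **the radial generator** `Q := Σ_r z_{(p₀,r)} z_{(q₀,r)}` of the plane `(p₀, q₀)`. [cite: Folland1989, Prop (4.39)] -/
def radQ (p₀ : P) (q₀ : Q) : MvPolynomial (DPIdx P Q R S) ℂ :=
  ∑ r : R, X (idxP R S p₀ r) * X (idxQ R S q₀ r)

/-- `Q · F = Σ_r z_{(p₀,r)} (z_{(q₀,r)} F)`. [folklore] -/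
theorem radQ_mul (p₀ : P) (q₀ : Q) (F : MvPolynomial (DPIdx P Q R S) ℂ) :
    radQ R S p₀ q₀ * F = ∑ r : R, X (idxP R S p₀ r) * (X (idxQ R S q₀ r) * F) := by
  rw [radQ, Finset.sum_mul]
  simp only [mul_assoc]

/-- **the radial Laplacian** `Δ G := Σ_r ∂_{(p₀,r)} ∂_{(q₀,r)} G`. [folklore] -/
def radLap (p₀ : P) (q₀ : Q) (G : MvPolynomial (DPIdx P Q R S) ℂ) : MvPolynomial (DPIdx P Q R S) ℂ :=
  ∑ r : R, pderiv (idxP R S p₀ r) (pderiv (idxQ R S q₀ r) G)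

/-- `Δ 1 = 0`. [folklore] -/
theorem radLap_one (p₀ : P) (q₀ : Q) : radLap R S p₀ q₀ 1 = 0 := by
  simp [radLap]

/-- **abstract pencil Laplacian**: if `∂_{(p₀,r)}∂_{(q₀,r)} L = a` for all `r` and `Σ_r ∂_{(p₀,r)}L ∂_{(q₀,r)}L = a L`,
then `Δ (L^{N+1}) = (N+1)(N+m) a L^N`. [folklore] -/
theorem radLap_pow_succ_of (p₀ : P) (q₀ : Q) (L : MvPolynomial (DPIdx P Q R S) ℂ) (a : ℂ)
    (hPQ : ∀ r : R, pderiv (idxP R S p₀ r) (pderiv (idxQ R S q₀ r) L) = C a)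
    (hsum : ∑ r : R, pderiv (idxP R S p₀ r) L * pderiv (idxQ R S q₀ r) L = C a * L) (N : ℕ) :
    radLap R S p₀ q₀ (L ^ (N + 1)) = ((((N : ℂ) + 1) * ((N : ℂ) + Fintype.card R)) * a) • L ^ N := by
  have h1 : ∀ r : R, pderiv (idxP R S p₀ r) (pderiv (idxQ R S q₀ r) (L ^ (N + 1))) =
      ((N : MvPolynomial (DPIdx P Q R S) ℂ) + 1) * ((N : MvPolynomial (DPIdx P Q R S) ℂ) * L ^ (N - 1) *
        (pderiv (idxP R S p₀ r) L * pderiv (idxQ R S q₀ r) L) + L ^ N * C a) := fun r => by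
    rw [pderiv_pow, Nat.add_sub_cancel, pderiv_mul, pderiv_mul, Derivation.map_natCast, zero_mul, zero_add,
      pderiv_pow, hPQ]
    push_cast
    ring
  rw [radLap]
  simp only [h1]
  rw [← Finset.mul_sum, Finset.sum_add_distrib, ← Finset.mul_sum, hsum, Finset.sum_const, Finset.card_univ,
    nsmul_eq_mul, smul_eq_C_mul, map_mul, map_mul, map_add, map_add, map_natCast, map_natCast, map_one]
  rcases N with _ | N
  · simp only [pow_zero, Nat.cast_zero, zero_mul, zero_add]
    ring
  · rw [Nat.add_sub_cancel]
    push_cast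
    ring

variable [Fintype P]

/-- the `P`-pencil `L_c := Σ_p c_p Σ_r z_{(p,r)} z_{(q₀,r)}` (the images of `Q` under the compact group). [folklore] -/
def radPencil (q₀ : Q) (c : P → ℂ) : MvPolynomial (DPIdx P Q R S) ℂ :=
  ∑ p : P, ∑ r : R, C (c p) * (X (idxP R S p r) * X (idxQ R S q₀ r))

variable [DecidableEq P] [DecidableEq R]

omit [DecidableEq R] in
/-- `Q` is the pencil of the indicator of `p₀`. [folklore] -/
theorem radPencil_ite (p₀ : P) (q₀ : Q) :
    radPencil R S q₀ (fun p => if p = p₀ then (1 : ℂ) else 0) = radQ R S p₀ q₀ := by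
  rw [radPencil, Finset.sum_eq_single_of_mem p₀ (Finset.mem_univ p₀)]
  · simp [radQ]
  · intro p _ hp
    simp [if_neg hp]

omit [DecidableEq P] in
/-- `∂_{(q₀,r)} L_c = Σ_p c_p z_{(p,r)}`. [folklore] -/
theorem pderiv_idxQ_radPencil (q₀ : Q) (c : P → ℂ) (r : R) :
    pderiv (idxQ R S q₀ r) (radPencil R S q₀ c) = ∑ p : P, C (c p) * X (idxP R S p r) := by
  have h : ∀ (p : P) (r' : R), pderiv (idxQ R S q₀ r) (C (c p) * (X (idxP R S p r') * X (idxQ R S q₀ r')) :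
      MvPolynomial (DPIdx P Q R S) ℂ) = if r' = r then C (c p) * X (idxP R S p r) else 0 := by
    intro p r'
    rw [pderiv_C_mul, pderiv_mul, pderiv_idxQ_X_idxP, pderiv_idxQ_X_idxQ, zero_mul, zero_add]
    split_ifs with h
    · rw [h, mul_one]
    · rw [mul_zero, mul_zero]
  simp only [radPencil, map_sum, h, Finset.sum_ite_eq', Finset.mem_univ, if_true]

/-- `∂_{(p₀,r)} L_c = c_{p₀} z_{(q₀,r)}`. [folklore] -/
theorem pderiv_idxP_radPencil (q₀ : Q) (c : P → ℂ) (p₀ : P) (r : R) :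
    pderiv (idxP R S p₀ r) (radPencil R S q₀ c) = C (c p₀) * X (idxQ R S q₀ r) := by
  have h : ∀ (p : P) (r' : R), pderiv (idxP R S p₀ r) (C (c p) * (X (idxP R S p r') * X (idxQ R S q₀ r')) :
      MvPolynomial (DPIdx P Q R S) ℂ) = if r' = r then (if p = p₀ then C (c p₀) * X (idxQ R S q₀ r) else 0) else 0 := by
    intro p r'
    rw [pderiv_C_mul, pderiv_mul, pderiv_idxP_X_idxP, pderiv_idxP_X_idxQ, mul_zero, add_zero]
    by_cases hr : r' = r
    · by_cases hp : p = p₀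
      · rw [if_pos ⟨hp, hr⟩, if_pos hr, if_pos hp, hp, hr, one_mul]
      · rw [if_neg (fun h => hp h.1), if_pos hr, if_neg hp, zero_mul, mul_zero]
    · rw [if_neg (fun h => hr h.2), if_neg hr, zero_mul, mul_zero]
  simp only [radPencil, map_sum, h, Finset.sum_ite_eq', Finset.mem_univ, if_true]

/-- `∂_{(p₀,r)} ∂_{(q₀,r)} L_c = c_{p₀}`. [folklore] -/
theorem pderiv_idxP_pderiv_idxQ_radPencil (q₀ : Q) (c : P → ℂ) (p₀ : P) (r : R) :
    pderiv (idxP R S p₀ r) (pderiv (idxQ R S q₀ r) (radPencil R S q₀ c)) = C (c p₀) := by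
  have h : ∀ p : P, pderiv (idxP R S p₀ r) (C (c p) * X (idxP R S p r) : MvPolynomial (DPIdx P Q R S) ℂ) =
      if p = p₀ then C (c p₀) else 0 := by
    intro p
    rw [pderiv_C_mul, pderiv_idxP_X_idxP]
    by_cases hp : p = p₀
    · rw [if_pos ⟨hp, rfl⟩, if_pos hp, hp, mul_one]
    · rw [if_neg (fun h => hp h.1), if_neg hp, mul_zero]
  rw [pderiv_idxQ_radPencil]
  simp only [map_sum, h, Finset.sum_ite_eq', Finset.mem_univ, if_true]

/-- `Σ_r ∂_{(p₀,r)} L_c · ∂_{(q₀,r)} L_c = c_{p₀} L_c`. [folklore] -/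
theorem sum_pderiv_mul_pderiv_radPencil (q₀ : Q) (c : P → ℂ) (p₀ : P) :
    ∑ r : R, pderiv (idxP R S p₀ r) (radPencil R S q₀ c) * pderiv (idxQ R S q₀ r) (radPencil R S q₀ c) =
      C (c p₀) * radPencil R S q₀ c := by
  simp only [pderiv_idxP_radPencil, pderiv_idxQ_radPencil]
  simp only [radPencil, Finset.mul_sum]
  rw [Finset.sum_comm]
  refine Finset.sum_congr rfl fun p _ => Finset.sum_congr rfl fun r _ => ?_
  ring

/-- **THE PENCIL LAPLACIAN**: `Δ (L_c^{N+1}) = (N+1)(N+m) c_{p₀} L_c^N`, `m = #R`. [folklore] -/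
theorem radLap_radPencil_pow_succ (q₀ : Q) (c : P → ℂ) (p₀ : P) (N : ℕ) :
    radLap R S p₀ q₀ (radPencil R S q₀ c ^ (N + 1)) =
      ((((N : ℂ) + 1) * ((N : ℂ) + Fintype.card R)) * c p₀) • radPencil R S q₀ c ^ N :=
  radLap_pow_succ_of R S p₀ q₀ _ _ (pderiv_idxP_pderiv_idxQ_radPencil R S q₀ c p₀)
    (sum_pderiv_mul_pderiv_radPencil R S q₀ c p₀) N

/-- **`Δ (Q^{N+1}) = (N+1)(N+m) Q^N`**. [cite: Folland1989, Prop (4.39)] -/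
theorem radLap_radQ_pow_succ (p₀ : P) (q₀ : Q) (N : ℕ) :
    radLap R S p₀ q₀ (radQ R S p₀ q₀ ^ (N + 1)) =
      (((N : ℂ) + 1) * ((N : ℂ) + Fintype.card R)) • radQ R S p₀ q₀ ^ N := by
  have h := radLap_radPencil_pow_succ R S q₀ (fun p => if p = p₀ then (1 : ℂ) else 0) p₀ N
  rwa [radPencil_ite, if_pos rfl, mul_one] at h

/-! ## §2  Fock pairings: `⟪Q^M, L_c^N⟫_𝓕 = δ_{MN} c_{p₀}^N w_N`, `w_{N+1} = w_N (N+1)(N+m)/π²` -/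

variable [Fintype Q] [DecidableEq Q] [Fintype S] [DecidableEq S]

attribute [local instance 10000] InnerProductSpace.toInner

/-- the right-hand peel `⟪F, z_j G⟫_𝓕 = π⁻¹ ⟪∂_j F, G⟫_𝓕`. [cite: Folland1989, Thm (1.63)] -/
theorem inner_fockToL2_X_mul_right {σ : Type*} [Fintype σ] (j : σ) (F G : MvPolynomial σ ℂ) :
    ⟪fockToL2 F, fockToL2 (X j * G)⟫_ℂ = (π : ℂ)⁻¹ * ⟪fockToL2 (pderiv j F), fockToL2 G⟫_ℂ := by
  rw [← inner_conj_symm, inner_fockToL2_X_mul, map_mul, map_inv₀, Complex.conj_ofReal, inner_conj_symm]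

/-- `⟪Q^{M+1}, G⟫_𝓕 = π⁻² ⟪Q^M, Δ G⟫_𝓕` (the two peels `z ↦ π⁻¹∂`). [cite: Folland1989, Thm (1.63)] -/
theorem inner_fockToL2_radQ_pow_succ_left (p₀ : P) (q₀ : Q) (M : ℕ) (G : MvPolynomial (DPIdx P Q R S) ℂ) :
    ⟪fockToL2 (radQ R S p₀ q₀ ^ (M + 1)), fockToL2 G⟫_ℂ =
      ((π : ℂ)⁻¹) ^ 2 * ⟪fockToL2 (radQ R S p₀ q₀ ^ M), fockToL2 (radLap R S p₀ q₀ G)⟫_ℂ := by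
  rw [pow_succ', radQ_mul, map_sum, sum_inner, radLap, map_sum, inner_sum, Finset.mul_sum]
  refine Finset.sum_congr rfl fun r _ => ?_
  rw [inner_fockToL2_X_mul, inner_fockToL2_X_mul, pderiv_pderiv_comm]
  ring

omit [DecidableEq P] [DecidableEq R] [DecidableEq Q] [DecidableEq S] in
/-- `⟪1, L_c^{N+1}⟫_𝓕 = 0`. [cite: Folland1989, Thm (1.63)] -/
theorem inner_fockToL2_one_radPencil_pow_succ (q₀ : Q) (c : P → ℂ) (N : ℕ) :
    ⟪fockToL2 (1 : MvPolynomial (DPIdx P Q R S) ℂ), fockToL2 (radPencil R S q₀ c ^ (N + 1))⟫_ℂ = 0 := by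
  rw [pow_succ']
  nth_rewrite 1 [radPencil]
  rw [Finset.sum_mul, map_sum, inner_sum]
  refine Finset.sum_eq_zero fun p _ => ?_
  rw [Finset.sum_mul, map_sum, inner_sum]
  refine Finset.sum_eq_zero fun r _ => ?_
  rw [mul_assoc, MvPolynomial.C_mul', map_smul, inner_smul_right (E := FockL2 (DPIdx P Q R S)), mul_assoc,
    inner_fockToL2_X_mul_right, pderiv_one, map_zero, inner_zero_left, mul_zero, mul_zero]

/-- `⟪1, 1⟫_𝓕 = 1`. [cite: Folland1989, Thm (1.63)] -/
theorem inner_fockToL2_one_one {σ : Type*} [Fintype σ] [DecidableEq σ] :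
    ⟪fockToL2 (1 : MvPolynomial σ ℂ), fockToL2 (1 : MvPolynomial σ ℂ)⟫_ℂ = 1 := by
  rw [← zeta_zero, inner_fockToL2_zeta_zeta, if_pos rfl]

/-- **`⟪Q^M, L_c^N⟫_𝓕 = δ_{MN} c_{p₀}^N w_N`** (double induction through `Δ (L_c^{N+1}) = (N+1)(N+m) c_{p₀} L_c^N`).
[cite: Folland1989, Thm (1.63), Prop (4.39)] -/
theorem inner_fockToL2_radQ_pow_radPencil_pow (q₀ : Q) (c : P → ℂ) (p₀ : P) (M N : ℕ) :
    ⟪fockToL2 (radQ R S p₀ q₀ ^ M), fockToL2 (radPencil R S q₀ c ^ N)⟫_ℂ =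
      if M = N then c p₀ ^ N * ((radW (Fintype.card R) N : ℝ) : ℂ) else 0 := by
  induction M generalizing N with
  | zero =>
    rcases N with _ | N
    · rw [pow_zero, pow_zero, inner_fockToL2_one_one, if_pos rfl, pow_zero, one_mul, radW, Complex.ofReal_one]
    · rw [pow_zero, inner_fockToL2_one_radPencil_pow_succ, if_neg (by omega)]
  | succ M ih =>
    rcases N with _ | N
    · rw [inner_fockToL2_radQ_pow_succ_left, pow_zero, radLap_one, map_zero, inner_zero_right, mul_zero,
        if_neg (by omega)]
    · rw [inner_fockToL2_radQ_pow_succ_left, radLap_radPencil_pow_succ, map_smul,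
        inner_smul_right (E := FockL2 (DPIdx P Q R S)), ih]
      by_cases hMN : M = N
      · subst hMN
        rw [if_pos rfl, if_pos rfl, radW]
        have hπ : (π : ℂ) ≠ 0 := Complex.ofReal_ne_zero.mpr Real.pi_ne_zero
        push_cast
        field_simp
        ring
      · rw [if_neg hMN, mul_zero, mul_zero, if_neg (by omega)]

/-- **`‖Q^N‖²_𝓕 = w_N`**. [cite: Folland1989, Thm (1.63)] -/
theorem inner_fockToL2_radQ_pow_self (p₀ : P) (q₀ : Q) (N : ℕ) :
    ⟪fockToL2 (radQ R S p₀ q₀ ^ N), fockToL2 (radQ R S p₀ q₀ ^ N)⟫_ℂ = ((radW (Fintype.card R) N : ℝ) : ℂ) := by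
  have h := inner_fockToL2_radQ_pow_radPencil_pow R S q₀ (fun p => if p = p₀ then (1 : ℂ) else 0) p₀ N N
  rwa [radPencil_ite, if_pos rfl, if_pos rfl, one_pow, one_mul] at h

/-- `⟪Q^M, Q^N⟫_𝓕 = δ_{MN} w_N`. [cite: Folland1989, Thm (1.63)] -/
theorem inner_fockToL2_radQ_pow_radQ_pow (p₀ : P) (q₀ : Q) (M N : ℕ) :
    ⟪fockToL2 (radQ R S p₀ q₀ ^ M), fockToL2 (radQ R S p₀ q₀ ^ N)⟫_ℂ =
      if M = N then ((radW (Fintype.card R) N : ℝ) : ℂ) else 0 := by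
  have h := inner_fockToL2_radQ_pow_radPencil_pow R S q₀ (fun p => if p = p₀ then (1 : ℂ) else 0) p₀ M N
  rwa [radPencil_ite, if_pos rfl, one_pow, one_mul] at h

omit [Fintype Q] [DecidableEq Q] [Fintype S] [DecidableEq S] in
/-- **`Σ_r (π z_{(p₀,r)} z_{(q₀,r)} + π⁻¹ ∂_{(p₀,r)}∂_{(q₀,r)}) (Q^N) = π Q^{N+1} + π⁻¹ N(N+m−1) Q^{N−1}`**: the Fock generator
closes on the ONE-index chain `Q^N`. [cite: Folland1989, Prop (4.39), (1.82)] -/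
theorem sum_hypPairSymb_radQ_pow (p₀ : P) (q₀ : Q) (N : ℕ) :
    ∑ r : R, hypPairSymb (idxP R S p₀ r) (idxQ R S q₀ r) (radQ R S p₀ q₀ ^ N) =
      (π : ℂ) • radQ R S p₀ q₀ ^ (N + 1) +
        ((Real.pi⁻¹ * ((N : ℝ) * ((N : ℝ) + Fintype.card R - 1)) : ℝ) : ℂ) • radQ R S p₀ q₀ ^ (N - 1) := by
  simp only [hypPairSymb, Finset.sum_add_distrib, ← Finset.smul_sum]
  rw [← radQ_mul, ← pow_succ', ← radLap]
  congr 1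
  rcases N with _ | N
  · simp [radLap_one]
  · rw [radLap_radQ_pow_succ, smul_smul, Nat.add_sub_cancel]
    congr 1
    push_cast
    ring

/-! ## §3  The radial functionals `E_N f := ⟪B⁻¹ Q^N, f⟫_{L²}` and the closed system along the generator -/

/-- the radial vector `B⁻¹ Q^N ∈ L²`. [folklore] -/
def radVec (p₀ : P) (q₀ : Q) (N : ℕ) : L2R (DPIdx P Q R S) := toL2 (binvPi (radQ R S p₀ q₀ ^ N))

/-- `E_N f := ⟪B⁻¹ Q^N, f⟫_{L²}` as a continuous linear functional on `𝓢`. [folklore] -/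
def radE (p₀ : P) (q₀ : Q) (N : ℕ) : (SR (DPIdx P Q R S)) →L[ℂ] ℂ :=
  (innerSL ℂ (radVec R S p₀ q₀ N)).comp (toL2 : (SR (DPIdx P Q R S)) →L[ℂ] L2R (DPIdx P Q R S))

/-- unfolding. [folklore] -/
theorem radE_apply (p₀ : P) (q₀ : Q) (N : ℕ) (f : SR (DPIdx P Q R S)) :
    radE R S p₀ q₀ N f = ⟪radVec R S p₀ q₀ N, toL2 f⟫_ℂ := rfl

/-- on the polynomial core: `E_N (B⁻¹F) = ⟪Q^N, F⟫_𝓕`. [cite: Folland1989, §1.7] -/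
theorem radE_binvPi (p₀ : P) (q₀ : Q) (N : ℕ) (F : MvPolynomial (DPIdx P Q R S) ℂ) :
    radE R S p₀ q₀ N (binvPi F) = ⟪fockToL2 (radQ R S p₀ q₀ ^ N), fockToL2 F⟫_ℂ := by
  rw [radE_apply, radVec, toL2_binvPi, toL2_binvPi, LinearIsometryEquiv.inner_map_map]

/-- `‖B⁻¹ Q^N‖² = w_N`. [cite: Folland1989, Thm (1.63)] -/
theorem norm_radVec_sq (p₀ : P) (q₀ : Q) (N : ℕ) : ‖radVec R S p₀ q₀ N‖ ^ 2 = radW (Fintype.card R) N := by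
  rw [@norm_sq_eq_re_inner ℂ, radVec, toL2_binvPi, LinearIsometryEquiv.inner_map_map, inner_fockToL2_radQ_pow_self,
    RCLike.re_to_complex, Complex.ofReal_re]

variable [IsEmpty S]

/-- **THE CLOSED SYSTEM on the core** (`S = ∅`): `E_N (G (B⁻¹F)) = −i (π E_{N+1} + π⁻¹ N(N+m−1) E_{N−1}) (B⁻¹F)`.
[cite: Folland1989, Prop (4.39), (1.82)] -/
theorem radE_hypOpGen_binvPi (p₀ : P) (q₀ : Q) (N : ℕ) (F : MvPolynomial (DPIdx P Q R S) ℂ) :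
    radE R S p₀ q₀ N (hypOpGen R S p₀ q₀ (binvPi F)) =
      -(I * ((π : ℂ) * radE R S p₀ q₀ (N + 1) (binvPi F) +
        ((Real.pi⁻¹ * ((N : ℝ) * ((N : ℝ) + Fintype.card R - 1)) : ℝ) : ℂ) * radE R S p₀ q₀ (N - 1) (binvPi F))) := by
  rw [hypOpGen_binvPi_frame, Finset.univ_eq_empty, Finset.sum_empty, zero_sub, radE_binvPi, radE_binvPi, radE_binvPi,
    map_smul, map_neg, inner_smul_right (E := FockL2 (DPIdx P Q R S)), inner_neg_right (E := FockL2 (DPIdx P Q R S)),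
    map_sum, inner_sum]
  simp only [inner_fockToL2_hypPairSymb]
  have hs := sum_hypPairSymb_radQ_pow R S p₀ q₀ N
  simp only [idxP, idxQ] at hs
  rw [← sum_inner, ← map_sum, hs, map_add, inner_add_left, map_smul, map_smul,
    inner_smul_left (E := FockL2 (DPIdx P Q R S)), inner_smul_left (E := FockL2 (DPIdx P Q R S)), Complex.conj_ofReal,
    Complex.conj_ofReal]
  ring

/-- **THE CLOSED SYSTEM on `𝓢`** (density of the core). [cite: Folland1989, §1.7, Prop (4.39)] -/
theorem radE_hypOpGen (p₀ : P) (q₀ : Q) (N : ℕ) (f : SR (DPIdx P Q R S)) :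
    radE R S p₀ q₀ N (hypOpGen R S p₀ q₀ f) =
      -(I * ((π : ℂ) * radE R S p₀ q₀ (N + 1) f +
        ((Real.pi⁻¹ * ((N : ℝ) * ((N : ℝ) + Fintype.card R - 1)) : ℝ) : ℂ) * radE R S p₀ q₀ (N - 1) f)) := by
  have key := clm_real_eq_of_eq_on_binvPi (σ := DPIdx P Q R S)
    (S := ((radE R S p₀ q₀ N).restrictScalars ℝ).comp (hypOpGen R S p₀ q₀))
    (T := (-(I • (((π : ℂ)) • radE R S p₀ q₀ (N + 1) +
      (((Real.pi⁻¹ * ((N : ℝ) * ((N : ℝ) + Fintype.card R - 1)) : ℝ) : ℂ)) • radE R S p₀ q₀ (N - 1)))).restrictScalars ℝ)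
    (fun F => by
      simp only [ContinuousLinearMap.comp_apply, ContinuousLinearMap.coe_restrictScalars',
        _root_.neg_apply, _root_.smul_apply, _root_.add_apply, smul_eq_mul]
      exact radE_hypOpGen_binvPi R S p₀ q₀ N F)
  have h2 := congrArg (fun T : (SR (DPIdx P Q R S)) →L[ℝ] ℂ => T f) key
  simpa only [ContinuousLinearMap.comp_apply, ContinuousLinearMap.coe_restrictScalars',
    _root_.neg_apply, _root_.smul_apply, _root_.add_apply, smul_eq_mul]
    using h2

/-! ## §4  The radial coefficient ODE along the hyperbolic family -/

/-- `a_N(s) := E_N (hypOp s h₀) = ⟪B⁻¹Q^N, hypOp s h₀⟫_{L²}`. [folklore] -/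
def radCoeff (p₀ : P) (q₀ : Q) (N : ℕ) (s : ℝ) : ℂ := radE R S p₀ q₀ N (hypOp R S p₀ q₀ s (hermitePi 0))

/-- **THE ODE** `a_N' = −i (π a_{N+1} + π⁻¹N(N+m−1) a_{N−1})`. [cite: Folland1989, (4.24), Prop (4.39)] -/
theorem hasDerivAt_radCoeff (p₀ : P) (q₀ : Q) (N : ℕ) (s : ℝ) :
    HasDerivAt (radCoeff R S p₀ q₀ N)
      (-(I * ((π : ℂ) * radCoeff R S p₀ q₀ (N + 1) s +
        ((Real.pi⁻¹ * ((N : ℝ) * ((N : ℝ) + Fintype.card R - 1)) : ℝ) : ℂ) * radCoeff R S p₀ q₀ (N - 1) s))) s := by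
  have h := hasDerivAt_apply_hypOp R S p₀ q₀ ((radE R S p₀ q₀ N).restrictScalars ℝ) (hermitePi 0) s
  rw [ContinuousLinearMap.coe_restrictScalars', radE_hypOpGen] at h
  exact h

omit [IsEmpty S] in
/-- `a_N(0) = δ_{N0}`. [folklore] -/
theorem radCoeff_zero_right (p₀ : P) (q₀ : Q) (N : ℕ) : radCoeff R S p₀ q₀ N 0 = if N = 0 then 1 else 0 := by
  rw [radCoeff, hypOp_zero, ContinuousLinearMap.coe_id', id, ← binvPi_zeta, zeta_zero, radE_binvPi,
    ← pow_zero (radQ R S p₀ q₀), inner_fockToL2_radQ_pow_radQ_pow]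
  split_ifs with h
  · rw [radW, Complex.ofReal_one]
  · rfl

omit [IsEmpty S] in
/-- `|a_N(s)|² ≤ w_N` (Cauchy–Schwarz against the unit vector `hypOp s h₀`). [folklore] -/
theorem norm_radCoeff_sq_le (p₀ : P) (q₀ : Q) (N : ℕ) (s : ℝ) : ‖radCoeff R S p₀ q₀ N s‖ ^ 2 ≤ radW (Fintype.card R) N := by
  rw [radCoeff, radE_apply, ← norm_radVec_sq R S p₀ q₀ N]
  have h := norm_inner_le_norm (𝕜 := ℂ) (radVec R S p₀ q₀ N) (toL2 (hypOp R S p₀ q₀ s (hermitePi 0)))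
  rw [norm_toL2_hypOp_hermitePi_zero, mul_one] at h
  exact pow_le_pow_left₀ (norm_nonneg _) h 2

/-! ## §5  The normalised coefficients `A_N = λ_N i^N a_N`: the candidate's recursion, `|A_N| ≤ 1` -/

/-- `c_N(s) := i^N a_N(s)` (phase removed). [folklore] -/
def radIc (p₀ : P) (q₀ : Q) (N : ℕ) (s : ℝ) : ℂ := I ^ N * radCoeff R S p₀ q₀ N s

/-- `c_N' = π⁻¹ N(N+m−1) c_{N−1} − π c_{N+1}` (real coefficients). [cite: Folland1989, Prop (4.39)] -/
theorem hasDerivAt_radIc (p₀ : P) (q₀ : Q) (N : ℕ) (s : ℝ) :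
    HasDerivAt (radIc R S p₀ q₀ N)
      (((Real.pi⁻¹ * ((N : ℝ) * ((N : ℝ) + Fintype.card R - 1)) : ℝ) : ℂ) * radIc R S p₀ q₀ (N - 1) s -
        (π : ℂ) * radIc R S p₀ q₀ (N + 1) s) s := by
  refine ((hasDerivAt_radCoeff R S p₀ q₀ N s).const_mul (I ^ N)).congr_deriv ?_
  simp only [radIc]
  rcases N with _ | N
  · push_cast
    ring
  · rw [Nat.add_sub_cancel]
    push_cast
    linear_combination (-(((π : ℂ))⁻¹ * (((N : ℂ) + 1) * ((N : ℂ) + 1 + (Fintype.card R : ℂ) - 1)) *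
      radCoeff R S p₀ q₀ N s * I ^ N)) * Complex.I_mul_I

/-- **`A_N(s) := λ_N i^N a_N(s)`**. [folklore] -/
def radA (p₀ : P) (q₀ : Q) (N : ℕ) (s : ℝ) : ℂ := (radLam (Fintype.card R) N : ℂ) * radIc R S p₀ q₀ N s

/-- **`A_N' = N A_{N−1} − (N+m) A_{N+1}`** — the recursion of the candidate `B_N = sech^m tanh^N`.
[cite: Folland1989, (4.24), Prop (4.39)] -/
theorem hasDerivAt_radA [Nonempty R] (p₀ : P) (q₀ : Q) (N : ℕ) (s : ℝ) :
    HasDerivAt (radA R S p₀ q₀ N)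
      ((N : ℂ) * radA R S p₀ q₀ (N - 1) s - ((N : ℂ) + Fintype.card R) * radA R S p₀ q₀ (N + 1) s) s := by
  refine ((hasDerivAt_radIc R S p₀ q₀ N s).const_mul ((radLam (Fintype.card R) N : ℝ) : ℂ)).congr_deriv ?_
  have hπ : (π : ℂ) ≠ 0 := Complex.ofReal_ne_zero.mpr Real.pi_ne_zero
  have hden : ∀ n : ℕ, ((n : ℂ) + ((Fintype.card R : ℕ) : ℂ)) ≠ 0 := fun n => by
    rw [← Nat.cast_add, Nat.cast_ne_zero]
    exact (Nat.add_pos_right n Fintype.card_pos).ne'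
  simp only [radA]
  rcases N with _ | N
  · have h0 := hden 0
    simp only [radLam]
    push_cast at h0 ⊢
    field_simp
    ring
  · have h0 := hden N
    have h1 := hden (N + 1)
    simp only [Nat.add_sub_cancel, radLam]
    push_cast at h0 h1 ⊢
    field_simp
    ring

omit [IsEmpty S] in
/-- `A_N(0) = δ_{N0}`. [folklore] -/
theorem radA_zero_right (p₀ : P) (q₀ : Q) (N : ℕ) : radA R S p₀ q₀ N 0 = if N = 0 then 1 else 0 := by
  rw [radA, radIc, radCoeff_zero_right]
  rcases N with _ | N
  · simp [radLam]
  · simp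

omit [IsEmpty S] in
/-- `C_N |A_N(s)|² ≤ 1` (from `|a_N|² ≤ w_N` and `C_N λ_N² w_N = 1`). [folklore] -/
theorem radC_mul_norm_radA_sq_le_one [Nonempty R] (p₀ : P) (q₀ : Q) (N : ℕ) (s : ℝ) :
    radC (Fintype.card R) N * ‖radA R S p₀ q₀ N s‖ ^ 2 ≤ 1 := by
  have hm : 0 < Fintype.card R := Fintype.card_pos
  rw [radA, radIc, norm_mul, norm_mul, norm_pow, Complex.norm_I, one_pow, one_mul, Complex.norm_real, Real.norm_eq_abs,
    abs_of_pos (radLam_pos hm N), mul_pow, ← mul_assoc, ← radC_mul_radLam_sq_mul_radW hm N]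
  exact mul_le_mul_of_nonneg_left (norm_radCoeff_sq_le R S p₀ q₀ N s)
    (mul_nonneg (radC_pos hm N).le (sq_nonneg _))

omit [IsEmpty S] in
/-- `|A_N(s)| ≤ 1`. [folklore] -/
theorem norm_radA_le_one [Nonempty R] (p₀ : P) (q₀ : Q) (N : ℕ) (s : ℝ) : ‖radA R S p₀ q₀ N s‖ ≤ 1 := by
  have hm : 0 < Fintype.card R := Fintype.card_pos
  have h := radC_mul_norm_radA_sq_le_one R S p₀ q₀ N s
  have h1 := one_le_radC hm N
  have h2 : ‖radA R S p₀ q₀ N s‖ ^ 2 ≤ 1 := by nlinarith [sq_nonneg ‖radA R S p₀ q₀ N s‖]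
  exact (pow_le_one_iff_of_nonneg (norm_nonneg _) two_ne_zero).mp h2

/-! ## §6  The energy identity `Σ_N C_N B_N(s) A_N(s) = 1` -/

/-- `u_N(s) := C_N B_N(s) A_N(s)`. [folklore] -/
def radU (p₀ : P) (q₀ : Q) (N : ℕ) (s : ℝ) : ℂ :=
  ((radC (Fintype.card R) N * radB (Fintype.card R) N s : ℝ) : ℂ) * radA R S p₀ q₀ N s

/-- `X_N := N C_N B_{N−1} A_N`. [folklore] -/
def radX (p₀ : P) (q₀ : Q) (N : ℕ) (s : ℝ) : ℂ :=
  (N : ℂ) * ((radC (Fintype.card R) N * radB (Fintype.card R) (N - 1) s : ℝ) : ℂ) * radA R S p₀ q₀ N s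

/-- `Y_N := N C_N B_N A_{N−1}`. [folklore] -/
def radY (p₀ : P) (q₀ : Q) (N : ℕ) (s : ℝ) : ℂ :=
  (N : ℂ) * ((radC (Fintype.card R) N * radB (Fintype.card R) N s : ℝ) : ℂ) * radA R S p₀ q₀ (N - 1) s

/-- **`u_N' = (X_N − X_{N+1}) + (Y_N − Y_{N+1})`** (uses `(N+m) C_N = (N+1) C_{N+1}`). [folklore] -/
theorem hasDerivAt_radU [Nonempty R] (p₀ : P) (q₀ : Q) (N : ℕ) (s : ℝ) :
    HasDerivAt (radU R S p₀ q₀ N)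
      (radX R S p₀ q₀ N s - radX R S p₀ q₀ (N + 1) s + (radY R S p₀ q₀ N s - radY R S p₀ q₀ (N + 1) s)) s := by
  have hB := (((hasDerivAt_radB (Fintype.card R) N s).const_mul (radC (Fintype.card R) N)).ofReal_comp).mul
    (hasDerivAt_radA R S p₀ q₀ N s)
  refine hB.congr_deriv ?_
  have hC : ((radC (Fintype.card R) (N + 1) : ℝ) : ℂ) * ((N : ℂ) + 1) =
      ((radC (Fintype.card R) N : ℝ) : ℂ) * ((N : ℂ) + (Fintype.card R : ℂ)) := by
    exact_mod_cast radC_succ_mul (Fintype.card R) N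
  simp only [radX, radY, Nat.add_sub_cancel]
  push_cast
  linear_combination ((radB (Fintype.card R) (N + 1) s : ℂ) * radA R S p₀ q₀ N s +
    (radB (Fintype.card R) N s : ℂ) * radA R S p₀ q₀ (N + 1) s) * hC

omit [IsEmpty S] in
/-- window bound `‖X_N(y)‖ ≤ N C_N T^{N−1}` on `{|tanh| ≤ T}`. [folklore] -/
theorem norm_radX_le [Nonempty R] (p₀ : P) (q₀ : Q) {T y : ℝ} (hT : |Real.sinh y / Real.cosh y| ≤ T) (N : ℕ) :
    ‖radX R S p₀ q₀ N y‖ ≤ (N : ℝ) * radC (Fintype.card R) N * T ^ (N - 1) := by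
  have hm : 0 < Fintype.card R := Fintype.card_pos
  rw [radX, norm_mul, norm_mul, Complex.norm_natCast, Complex.ofReal_mul, norm_mul, Complex.norm_real, Real.norm_eq_abs,
    abs_of_pos (radC_pos hm N)]
  have h := mul_le_mul (norm_ofReal_radB_le hT (Fintype.card R) (N - 1)) (norm_radA_le_one R S p₀ q₀ N y)
    (norm_nonneg _) (pow_nonneg ((abs_nonneg _).trans hT) _)
  rw [mul_one] at h
  calc (N : ℝ) * (radC (Fintype.card R) N * ‖(radB (Fintype.card R) (N - 1) y : ℂ)‖) * ‖radA R S p₀ q₀ N y‖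
        = ((N : ℝ) * radC (Fintype.card R) N) * (‖(radB (Fintype.card R) (N - 1) y : ℂ)‖ * ‖radA R S p₀ q₀ N y‖) := by
          ring
    _ ≤ ((N : ℝ) * radC (Fintype.card R) N) * T ^ (N - 1) :=
          mul_le_mul_of_nonneg_left h (mul_nonneg (Nat.cast_nonneg N) (radC_pos hm N).le)

omit [IsEmpty S] in
/-- window bound `‖Y_N(y)‖ ≤ N C_N T^{N−1}` on `{|tanh| ≤ T ≤ 1}`. [folklore] -/
theorem norm_radY_le [Nonempty R] (p₀ : P) (q₀ : Q) {T y : ℝ} (hT : |Real.sinh y / Real.cosh y| ≤ T) (hT1 : T ≤ 1)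
    (N : ℕ) : ‖radY R S p₀ q₀ N y‖ ≤ (N : ℝ) * radC (Fintype.card R) N * T ^ (N - 1) := by
  have hm : 0 < Fintype.card R := Fintype.card_pos
  have hT0 : 0 ≤ T := (abs_nonneg _).trans hT
  rw [radY, norm_mul, norm_mul, Complex.norm_natCast, Complex.ofReal_mul, norm_mul, Complex.norm_real, Real.norm_eq_abs,
    abs_of_pos (radC_pos hm N)]
  have h := mul_le_mul (norm_ofReal_radB_le hT (Fintype.card R) N) (norm_radA_le_one R S p₀ q₀ (N - 1) y)
    (norm_nonneg _) (pow_nonneg hT0 _)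
  have h5 : T ^ N ≤ T ^ (N - 1) := pow_le_pow_of_le_one hT0 hT1 (Nat.sub_le N 1)
  rw [mul_one] at h
  calc (N : ℝ) * (radC (Fintype.card R) N * ‖(radB (Fintype.card R) N y : ℂ)‖) * ‖radA R S p₀ q₀ (N - 1) y‖
        = ((N : ℝ) * radC (Fintype.card R) N) * (‖(radB (Fintype.card R) N y : ℂ)‖ * ‖radA R S p₀ q₀ (N - 1) y‖) := by
          ring
    _ ≤ ((N : ℝ) * radC (Fintype.card R) N) * T ^ (N - 1) :=
          mul_le_mul_of_nonneg_left (h.trans h5) (mul_nonneg (Nat.cast_nonneg N) (radC_pos hm N).le)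

omit [IsEmpty S] in
/-- the Weierstrass majorant of `u_N'` on `{|tanh| ≤ T ≤ 1}`. [folklore] -/
theorem norm_radU'_le [Nonempty R] (p₀ : P) (q₀ : Q) {T y : ℝ} (hT : |Real.sinh y / Real.cosh y| ≤ T) (hT1 : T ≤ 1)
    (N : ℕ) :
    ‖radX R S p₀ q₀ N y - radX R S p₀ q₀ (N + 1) y + (radY R S p₀ q₀ N y - radY R S p₀ q₀ (N + 1) y)‖ ≤
      2 * ((N : ℝ) * radC (Fintype.card R) N * T ^ (N - 1)) +
        2 * ((((N + 1 : ℕ) : ℝ)) * radC (Fintype.card R) (N + 1) * T ^ (N + 1 - 1)) := by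
  have h1 := norm_radX_le R S p₀ q₀ hT N
  have h2 := norm_radX_le R S p₀ q₀ hT (N + 1)
  have h3 := norm_radY_le R S p₀ q₀ hT hT1 N
  have h4 := norm_radY_le R S p₀ q₀ hT hT1 (N + 1)
  refine (norm_add_le _ _).trans ?_
  have h5 := norm_sub_le (radX R S p₀ q₀ N y) (radX R S p₀ q₀ (N + 1) y)
  have h6 := norm_sub_le (radY R S p₀ q₀ N y) (radY R S p₀ q₀ (N + 1) y)
  linarith

omit [IsEmpty S] in
/-- the energy series is summable. [folklore] -/
theorem summable_radU [Nonempty R] (p₀ : P) (q₀ : Q) (s : ℝ) : Summable fun N => radU R S p₀ q₀ N s := by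
  have hm : 0 < Fintype.card R := Fintype.card_pos
  refine Summable.of_norm_bounded (summable_radC_mul_pow hm (abs_nonneg _) (abs_tanh_lt_one s)) fun N => ?_
  rw [radU, norm_mul, Complex.ofReal_mul, norm_mul, Complex.norm_real, Real.norm_eq_abs, abs_of_pos (radC_pos hm N),
    mul_assoc]
  refine mul_le_mul_of_nonneg_left ?_ (radC_pos hm N).le
  have h := mul_le_mul (norm_ofReal_radB_le (le_refl |Real.sinh s / Real.cosh s|) (Fintype.card R) N)
    (norm_radA_le_one R S p₀ q₀ N s) (norm_nonneg _) (pow_nonneg (abs_nonneg _) N)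
  linarith

/-- term-by-term differentiation of `Σ_N u_N` on the window `(s₀−1, s₀+1)`. [folklore] -/
theorem hasDerivAt_tsum_radU [Nonempty R] (p₀ : P) (q₀ : Q) (s₀ : ℝ) :
    HasDerivAt (fun s => ∑' N, radU R S p₀ q₀ N s)
      (∑' N, (radX R S p₀ q₀ N s₀ - radX R S p₀ q₀ (N + 1) s₀ + (radY R S p₀ q₀ N s₀ - radY R S p₀ q₀ (N + 1) s₀)))
      s₀ := by
  have hm : 0 < Fintype.card R := Fintype.card_pos
  obtain ⟨T, hT0, hT1, hT⟩ := exists_abs_tanh_le s₀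
  have hmem : s₀ ∈ Set.Ioo (s₀ - 1) (s₀ + 1) := ⟨by linarith, by linarith⟩
  have hmaj : Summable fun N : ℕ => 2 * ((N : ℝ) * radC (Fintype.card R) N * T ^ (N - 1)) +
      2 * ((((N + 1 : ℕ) : ℝ)) * radC (Fintype.card R) (N + 1) * T ^ (N + 1 - 1)) :=
    ((summable_mul_radC_mul_pow hm hT0 hT1).mul_left 2).add
      (((summable_nat_add_iff 1).mpr (summable_mul_radC_mul_pow hm hT0 hT1)).mul_left 2)
  exact hasDerivAt_tsum_of_isPreconnected hmaj isOpen_Ioo (convex_Ioo (s₀ - 1) (s₀ + 1)).isPreconnected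
    (fun N y _ => hasDerivAt_radU R S p₀ q₀ N y)
    (fun N y hy => norm_radU'_le R S p₀ q₀ (hT y (Set.Ioo_subset_Icc_self hy)) hT1.le N) hmem
    (summable_radU R S p₀ q₀ s₀) hmem

omit [IsEmpty S] in
/-- **the derivative series telescopes to zero** (`X`, `Y` absolutely summable, `X_0 = Y_0 = 0`). [folklore] -/
theorem tsum_radU'_eq_zero [Nonempty R] (p₀ : P) (q₀ : Q) (s : ℝ) :
    ∑' N, (radX R S p₀ q₀ N s - radX R S p₀ q₀ (N + 1) s + (radY R S p₀ q₀ N s - radY R S p₀ q₀ (N + 1) s)) = 0 := by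
  have hm : 0 < Fintype.card R := Fintype.card_pos
  have ht := abs_tanh_lt_one s
  have hmaj := summable_mul_radC_mul_pow hm (abs_nonneg _) ht
  have hX : Summable fun N => radX R S p₀ q₀ N s :=
    Summable.of_norm_bounded hmaj fun N => norm_radX_le R S p₀ q₀ (le_refl |Real.sinh s / Real.cosh s|) N
  have hY : Summable fun N => radY R S p₀ q₀ N s :=
    Summable.of_norm_bounded hmaj fun N => norm_radY_le R S p₀ q₀ (le_refl |Real.sinh s / Real.cosh s|) ht.le N
  have hX0 : radX R S p₀ q₀ 0 s = 0 := by simp [radX]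
  have hY0 : radY R S p₀ q₀ 0 s = 0 := by simp [radY]
  have hX1 := (hasSum_nat_add_iff' 1).mpr hX.hasSum
  have hY1 := (hasSum_nat_add_iff' 1).mpr hY.hasSum
  rw [Finset.sum_range_one] at hX1 hY1
  have hsum := (hX.hasSum.sub hX1).add (hY.hasSum.sub hY1)
  rw [hX0, hY0] at hsum
  rw [hsum.tsum_eq]
  ring

/-- **ENERGY IDENTITY** `Σ_N C_N B_N(s) A_N(s) = 1` (derivative zero, value `1` at `s = 0`). [folklore] -/
theorem tsum_radU_eq_one [Nonempty R] (p₀ : P) (q₀ : Q) (s : ℝ) : ∑' N, radU R S p₀ q₀ N s = 1 := by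
  have hF : ∀ x, HasDerivAt (fun s => ∑' N, radU R S p₀ q₀ N s) 0 x := fun x => by
    simpa only [tsum_radU'_eq_zero] using hasDerivAt_tsum_radU R S p₀ q₀ x
  rw [is_const_of_deriv_eq_zero (fun x => (hF x).differentiableAt) (fun x => (hF x).deriv) s 0]
  refine (tsum_eq_single 0 fun N hN => ?_).trans ?_
  · rw [radU, radA_zero_right, if_neg hN, mul_zero]
  · rw [radU, radA_zero_right, radB_zero_right, if_pos rfl, if_pos rfl, radC]
    push_cast
    ring

/-! ## §7  Conclusion: `A_N = B_N` (Bessel over the radial vectors + the energy identity + `Σ C_N B_N² = 1`) -/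

/-- real part of the energy identity. [folklore] -/
theorem hasSum_radC_mul_radB_mul_re_radA [Nonempty R] (p₀ : P) (q₀ : Q) (s : ℝ) :
    HasSum (fun N => radC (Fintype.card R) N * radB (Fintype.card R) N s * (radA R S p₀ q₀ N s).re) 1 := by
  have h := Complex.hasSum_re (summable_radU R S p₀ q₀ s).hasSum
  rw [tsum_radU_eq_one, Complex.one_re] at h
  have e : (fun N => (radU R S p₀ q₀ N s).re) =
      fun N => radC (Fintype.card R) N * radB (Fintype.card R) N s * (radA R S p₀ q₀ N s).re := by
    funext N
    simp [radU, Complex.mul_re]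
  rw [e] at h
  exact h

omit [IsEmpty S] in
/-- `⟪B⁻¹Q^M, B⁻¹Q^N⟫_{L²} = δ_{MN} w_N`. [cite: Folland1989, Thm (1.63)] -/
theorem inner_radVec_radVec (p₀ : P) (q₀ : Q) (M N : ℕ) :
    ⟪radVec R S p₀ q₀ M, radVec R S p₀ q₀ N⟫_ℂ = if M = N then ((radW (Fintype.card R) N : ℝ) : ℂ) else 0 := by
  rw [radVec, radVec, toL2_binvPi, toL2_binvPi, LinearIsometryEquiv.inner_map_map, inner_fockToL2_radQ_pow_radQ_pow]

/-- the orthonormalised radial vectors `e_N := w_N^{-1/2} B⁻¹Q^N`. [folklore] -/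
def radOn (p₀ : P) (q₀ : Q) (N : ℕ) : L2R (DPIdx P Q R S) :=
  ((Real.sqrt (radW (Fintype.card R) N))⁻¹ : ℂ) • radVec R S p₀ q₀ N

omit [IsEmpty S] in
/-- `(e_N)` is orthonormal. [cite: Folland1989, Thm (1.63)] -/
theorem orthonormal_radOn [Nonempty R] (p₀ : P) (q₀ : Q) : Orthonormal ℂ (radOn R S p₀ q₀) := by
  have hm : 0 < Fintype.card R := Fintype.card_pos
  rw [orthonormal_iff_ite]
  intro M N
  rw [radOn, radOn, inner_smul_left (E := L2R (DPIdx P Q R S)), inner_smul_right (E := L2R (DPIdx P Q R S)),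
    inner_radVec_radVec, map_inv₀, Complex.conj_ofReal]
  split_ifs with h
  · subst h
    have hw := radW_pos hm M
    rw [← mul_assoc, ← mul_inv, ← Complex.ofReal_mul, Real.mul_self_sqrt hw.le,
      inv_mul_cancel₀ (Complex.ofReal_ne_zero.mpr hw.ne')]
  · rw [mul_zero, mul_zero]

omit [IsEmpty S] in
/-- `‖⟪e_N, ψ_s⟫‖² = C_N |A_N(s)|²`. [folklore] -/
theorem norm_inner_radOn_sq [Nonempty R] (p₀ : P) (q₀ : Q) (N : ℕ) (s : ℝ) :
    ‖⟪radOn R S p₀ q₀ N, toL2 (hypOp R S p₀ q₀ s (hermitePi 0 : SR (DPIdx P Q R S)))⟫_ℂ‖ ^ 2 =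
      radC (Fintype.card R) N * ‖radA R S p₀ q₀ N s‖ ^ 2 := by
  have hm : 0 < Fintype.card R := Fintype.card_pos
  have hw := radW_pos hm N
  have key := radC_mul_radLam_sq_mul_radW hm N
  rw [radOn, inner_smul_left (E := L2R (DPIdx P Q R S)), ← radE_apply, ← radCoeff, radA, radIc, map_inv₀,
    Complex.conj_ofReal]
  simp only [norm_mul, norm_inv, norm_pow, Complex.norm_real, Complex.norm_I, Real.norm_eq_abs, one_pow, one_mul]
  rw [abs_of_pos (Real.sqrt_pos.mpr hw), abs_of_pos (radLam_pos hm N), mul_pow, mul_pow, inv_pow, Real.sq_sqrt hw.le]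
  have hw' : radW (Fintype.card R) N ≠ 0 := hw.ne'
  field_simp
  linear_combination (-(‖radCoeff R S p₀ q₀ N s‖ ^ 2)) * key

omit [IsEmpty S] in
/-- Bessel over the radial vectors: `Σ_N C_N |A_N(s)|² ≤ ‖ψ_s‖² = 1`. [folklore] -/
theorem exists_hasSum_radC_mul_norm_radA_sq [Nonempty R] (p₀ : P) (q₀ : Q) (s : ℝ) :
    ∃ A : ℝ, A ≤ 1 ∧ HasSum (fun N => radC (Fintype.card R) N * ‖radA R S p₀ q₀ N s‖ ^ 2) A := by
  set ψ := toL2 (hypOp R S p₀ q₀ s (hermitePi 0 : SR (DPIdx P Q R S))) with hψ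
  have hv := orthonormal_radOn R S p₀ q₀
  have e : ∀ N, ‖⟪radOn R S p₀ q₀ N, ψ⟫_ℂ‖ ^ 2 = radC (Fintype.card R) N * ‖radA R S p₀ q₀ N s‖ ^ 2 :=
    fun N => norm_inner_radOn_sq R S p₀ q₀ N s
  refine ⟨∑' N, radC (Fintype.card R) N * ‖radA R S p₀ q₀ N s‖ ^ 2, ?_,
    ((hv.inner_products_summable ψ).congr e).hasSum⟩
  have hB := hv.tsum_inner_products_le ψ
  rw [norm_toL2_hypOp_hermitePi_zero, one_pow, tsum_congr e] at hB
  exact hB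

/-- **`A_N(s) = B_N(s)`**: `0 ≤ Σ_N C_N |A_N − B_N|² = Σ C_N|A_N|² − 2 Σ C_N B_N Re A_N + Σ C_N B_N² ≤ 1 − 2 + 1 = 0`.
[folklore] -/
theorem radA_eq_radB [Nonempty R] (p₀ : P) (q₀ : Q) (N : ℕ) (s : ℝ) :
    radA R S p₀ q₀ N s = (radB (Fintype.card R) N s : ℂ) := by
  have hm : 0 < Fintype.card R := Fintype.card_pos
  obtain ⟨A, hA1, hA⟩ := exists_hasSum_radC_mul_norm_radA_sq R S p₀ q₀ s
  have hsum := (hA.sub ((hasSum_radC_mul_radB_mul_re_radA R S p₀ q₀ s).mul_left 2)).add (hasSum_radC_mul_radB_sq hm s)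
  have hnn : ∀ M, radC (Fintype.card R) M * ‖radA R S p₀ q₀ M s‖ ^ 2 -
      2 * (radC (Fintype.card R) M * radB (Fintype.card R) M s * (radA R S p₀ q₀ M s).re) +
        radC (Fintype.card R) M * radB (Fintype.card R) M s ^ 2 =
      radC (Fintype.card R) M * ‖radA R S p₀ q₀ M s - radB (Fintype.card R) M s‖ ^ 2 := fun M => by
    rw [Complex.sq_norm, Complex.sq_norm, Complex.normSq_apply, Complex.normSq_apply, Complex.sub_re, Complex.sub_im,
      Complex.ofReal_re, Complex.ofReal_im]
    ring
  simp only [hnn] at hsum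
  have hle := le_hasSum hsum N fun j _ => mul_nonneg (radC_pos hm j).le (sq_nonneg _)
  have h0 : radC (Fintype.card R) N * ‖radA R S p₀ q₀ N s - radB (Fintype.card R) N s‖ ^ 2 ≤ 0 := hle.trans (by linarith)
  have hsq : ‖radA R S p₀ q₀ N s - radB (Fintype.card R) N s‖ ^ 2 ≤ 0 := by
    by_contra hcon
    exact absurd h0 (not_le.mpr (mul_pos (radC_pos hm N) (not_le.mp hcon)))
  have h00 : ‖radA R S p₀ q₀ N s - radB (Fintype.card R) N s‖ = 0 :=
    pow_eq_zero_iff (two_ne_zero) |>.mp (le_antisymm hsq (sq_nonneg _))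
  rwa [norm_eq_zero, sub_eq_zero] at h00

/-- **THE RADIAL COEFFICIENTS OF THE SQUEEZED VACUUM**: `a_N(s) = ⟪B⁻¹Q^N, hypOp s h₀⟫ = (−i)^N λ_N⁻¹ sech^m s tanh^N s`.
[cite: Folland1989, Prop (4.39), (4.24)] -/
theorem radCoeff_eq [Nonempty R] (p₀ : P) (q₀ : Q) (N : ℕ) (s : ℝ) :
    radCoeff R S p₀ q₀ N s =
      (-I) ^ N * (((radLam (Fintype.card R) N)⁻¹ * radB (Fintype.card R) N s : ℝ) : ℂ) := by
  have hm : 0 < Fintype.card R := Fintype.card_pos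
  have h := radA_eq_radB R S p₀ q₀ N s
  rw [radA, radIc] at h
  have hI : (-I) ^ N * I ^ N = 1 := by rw [← mul_pow, neg_mul, Complex.I_mul_I, neg_neg, one_pow]
  have hl : ((radLam (Fintype.card R) N : ℝ) : ℂ) ≠ 0 := Complex.ofReal_ne_zero.mpr (radLam_pos hm N).ne'
  rw [Complex.ofReal_mul, Complex.ofReal_inv, ← h, inv_mul_cancel_left₀ hl, ← mul_assoc, hI, one_mul]

/-! ## §8  The squeezed vacuum expands along the radial chain in `L²` -/

omit [Fintype R] [Fintype P] [DecidableEq P] [DecidableEq R] [Fintype Q] [DecidableEq Q] [Fintype S] [DecidableEq S]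
  [IsEmpty S] in
/-- Bessel's identity: `‖x − Σ_{i∈F} ⟪v_i,x⟫ v_i‖² = ‖x‖² − Σ_{i∈F} |⟪v_i,x⟫|²` for an orthonormal family. [folklore] -/
theorem norm_sub_sum_inner_smul_sq {ι E : Type*} [NormedAddCommGroup E] [InnerProductSpace ℂ E] {v : ι → E}
    (hv : Orthonormal ℂ v) (x : E) (F : Finset ι) :
    ‖x - ∑ i ∈ F, ⟪v i, x⟫_ℂ • v i‖ ^ 2 = ‖x‖ ^ 2 - ∑ i ∈ F, ‖⟪v i, x⟫_ℂ‖ ^ 2 := by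
  have h1 : ⟪x, ∑ i ∈ F, ⟪v i, x⟫_ℂ • v i⟫_ℂ = ∑ i ∈ F, ((‖⟪v i, x⟫_ℂ‖ ^ 2 : ℝ) : ℂ) := by
    rw [inner_sum]
    refine Finset.sum_congr rfl fun i _ => ?_
    rw [inner_smul_right, ← inner_conj_symm x (v i), Complex.mul_conj, Complex.normSq_eq_norm_sq]
  have h2 : ‖∑ i ∈ F, ⟪v i, x⟫_ℂ • v i‖ ^ 2 = ∑ i ∈ F, ‖⟪v i, x⟫_ℂ‖ ^ 2 := by
    rw [@norm_sq_eq_re_inner ℂ, hv.inner_sum, RCLike.re_to_complex, Complex.re_sum]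
    refine Finset.sum_congr rfl fun i _ => ?_
    rw [mul_comm, Complex.mul_conj, Complex.normSq_eq_norm_sq, Complex.ofReal_re]
  rw [@norm_sub_sq ℂ, h1, h2, RCLike.re_to_complex, Complex.re_sum]
  simp only [Complex.ofReal_re]
  ring

omit [Fintype R] [Fintype P] [DecidableEq P] [DecidableEq R] [Fintype Q] [DecidableEq Q] [Fintype S] [DecidableEq S]
  [IsEmpty S] in
/-- an orthonormal family with Parseval's equality at `x` expands `x`. [folklore] -/
theorem hasSum_inner_smul_of_hasSum_norm_sq {ι E : Type*} [NormedAddCommGroup E] [InnerProductSpace ℂ E] {v : ι → E}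
    (hv : Orthonormal ℂ v) {x : E} (hP : HasSum (fun i => ‖⟪v i, x⟫_ℂ‖ ^ 2) (‖x‖ ^ 2)) :
    HasSum (fun i => ⟪v i, x⟫_ℂ • v i) x := by
  have key : ∀ F : Finset ι, ‖∑ i ∈ F, ⟪v i, x⟫_ℂ • v i - x‖ =
      Real.sqrt (‖x‖ ^ 2 - ∑ i ∈ F, ‖⟪v i, x⟫_ℂ‖ ^ 2) := fun F => by
    rw [norm_sub_rev, ← norm_sub_sum_inner_smul_sq hv x F, Real.sqrt_sq (norm_nonneg _)]
  unfold HasSum at hP ⊢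
  simp only [SummationFilter.unconditional_filter] at hP ⊢
  rw [tendsto_iff_norm_sub_tendsto_zero]
  simp only [key]
  have h := (tendsto_const_nhds (x := ‖x‖ ^ 2)).sub hP
  rw [sub_self] at h
  have h2 := h.sqrt
  rwa [Real.sqrt_zero] at h2

/-- **the squeezed vacuum expands along the radial chain** (in `L²`): `hypOp s h₀ = Σ_N ⟪e_N, hypOp s h₀⟫ e_N`.
[cite: Folland1989, Prop (4.39), (1.82)] -/
theorem hasSum_inner_radOn_smul_radOn [Nonempty R] (p₀ : P) (q₀ : Q) (s : ℝ) :
    HasSum (fun N => ⟪radOn R S p₀ q₀ N, toL2 (hypOp R S p₀ q₀ s (hermitePi 0 : SR (DPIdx P Q R S)))⟫_ℂ •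
        radOn R S p₀ q₀ N)
      (toL2 (hypOp R S p₀ q₀ s (hermitePi 0 : SR (DPIdx P Q R S)))) := by
  refine hasSum_inner_smul_of_hasSum_norm_sq (orthonormal_radOn R S p₀ q₀) ?_
  rw [norm_toL2_hypOp_hermitePi_zero, one_pow]
  simp only [norm_inner_radOn_sq, radA_eq_radB, Complex.norm_real, Real.norm_eq_abs, sq_abs]
  exact hasSum_radC_mul_radB_sq Fintype.card_pos s

omit [IsEmpty S] in
/-- `⟪e_N, hypOp s h₀⟫ = w_N^{-1/2} a_N(s)`. [folklore] -/
theorem inner_radOn_toL2_hypOp (p₀ : P) (q₀ : Q) (N : ℕ) (s : ℝ) :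
    ⟪radOn R S p₀ q₀ N, toL2 (hypOp R S p₀ q₀ s (hermitePi 0 : SR (DPIdx P Q R S)))⟫_ℂ =
      (((Real.sqrt (radW (Fintype.card R) N))⁻¹ : ℝ) : ℂ) * radCoeff R S p₀ q₀ N s := by
  rw [radOn, inner_smul_left (E := L2R (DPIdx P Q R S)), map_inv₀, Complex.conj_ofReal, ← radE_apply, ← radCoeff,
    Complex.ofReal_inv]

/-- the `N`-th overlap weight: `⟪e_N, ψ_s⟫ conj⟪e_N, ψ_t⟫ = C_N B_N(t) B_N(s)`. [folklore] -/
theorem inner_radOn_mul_conj_inner_radOn [Nonempty R] (p₀ : P) (q₀ : Q) (N : ℕ) (t s : ℝ) :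
    ⟪radOn R S p₀ q₀ N, toL2 (hypOp R S p₀ q₀ s (hermitePi 0 : SR (DPIdx P Q R S)))⟫_ℂ *
        conj ⟪radOn R S p₀ q₀ N, toL2 (hypOp R S p₀ q₀ t (hermitePi 0 : SR (DPIdx P Q R S)))⟫_ℂ =
      ((radC (Fintype.card R) N * (radB (Fintype.card R) N t * radB (Fintype.card R) N s) : ℝ) : ℂ) := by
  have hm : 0 < Fintype.card R := Fintype.card_pos
  have hw := radW_pos hm N
  have hl := radLam_pos hm N
  have key := radC_mul_radLam_sq_mul_radW hm N
  rw [inner_radOn_toL2_hypOp, inner_radOn_toL2_hypOp, radCoeff_eq, radCoeff_eq, map_mul, Complex.conj_ofReal, map_mul,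
    map_pow, map_neg, Complex.conj_I, neg_neg, Complex.conj_ofReal]
  have hI : (-I) ^ N * I ^ N = 1 := by rw [← mul_pow, neg_mul, Complex.I_mul_I, neg_neg, one_pow]
  have hsw : (Real.sqrt (radW (Fintype.card R) N))⁻¹ * (Real.sqrt (radW (Fintype.card R) N))⁻¹ *
      ((radLam (Fintype.card R) N)⁻¹ * (radLam (Fintype.card R) N)⁻¹) = radC (Fintype.card R) N := by
    rw [← mul_inv, Real.mul_self_sqrt hw.le, ← mul_inv, ← mul_inv]
    refine (eq_inv_of_mul_eq_one_left ?_).symm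
    linear_combination key
  calc (((Real.sqrt (radW (Fintype.card R) N))⁻¹ : ℝ) : ℂ) *
          ((-I) ^ N * ((((radLam (Fintype.card R) N)⁻¹ * radB (Fintype.card R) N s : ℝ)) : ℂ)) *
        ((((Real.sqrt (radW (Fintype.card R) N))⁻¹ : ℝ) : ℂ) *
          (I ^ N * ((((radLam (Fintype.card R) N)⁻¹ * radB (Fintype.card R) N t : ℝ)) : ℂ)))
        = ((-I) ^ N * I ^ N) * (((Real.sqrt (radW (Fintype.card R) N))⁻¹ * (Real.sqrt (radW (Fintype.card R) N))⁻¹ *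
            ((radLam (Fintype.card R) N)⁻¹ * (radLam (Fintype.card R) N)⁻¹) *
              (radB (Fintype.card R) N t * radB (Fintype.card R) N s) : ℝ) : ℂ) := by
          push_cast
          ring
    _ = ((radC (Fintype.card R) N * (radB (Fintype.card R) N t * radB (Fintype.card R) N s) : ℝ) : ℂ) := by
          rw [hI, one_mul, hsw]

/-! ## §9  (K-b′) The block datum maps the radial generator to a pencil: `Q ∘ ι(k)⁻¹ = Σ_{p'} a_{p'p₀} b̄_{q₀q₀} Q_{p'}` -/

omit [IsEmpty S] in
/-- `(X_{(p₀,r)}) ∘ ι(k)⁻¹ = Σ_{p',r'} a_{p'p₀} c_{r'r} X_{(p',r')}`. [folklore] -/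
theorem linSubst_star_dualPairι_X_idxP (k : DPK P Q R S) (p₀ : P) (r : R) :
    linSubst (star ((dualPairι k : Matrix.unitaryGroup (DPIdx P Q R S) ℂ) :
        Matrix (DPIdx P Q R S) (DPIdx P Q R S) ℂ)) (X (idxP R S p₀ r)) =
      ∑ p' : P, ∑ r' : R, C ((k.1.1 : Matrix P P ℂ) p' p₀ * (k.2.1 : Matrix R R ℂ) r' r) * X (idxP R S p' r') := by
  rw [linSubst_X, coe_dualPairι]
  simp only [idxP, Fintype.sum_sum_type, Fintype.sum_prod_type, Matrix.star_apply, Matrix.fromBlocks_apply₁₁,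
    Matrix.fromBlocks_apply₂₁, Matrix.map_apply, Matrix.kroneckerMap_apply, star_mul', star_star, Matrix.zero_apply,
    star_zero, map_zero, zero_mul, Finset.sum_const_zero, add_zero]

omit [IsEmpty S] in
/-- `(X_{(q₀,r)}) ∘ ι(k)⁻¹ = Σ_{q',r'} b̄_{q'q₀} c̄_{r'r} X_{(q',r')}`. [folklore] -/
theorem linSubst_star_dualPairι_X_idxQ (k : DPK P Q R S) (q₀ : Q) (r : R) :
    linSubst (star ((dualPairι k : Matrix.unitaryGroup (DPIdx P Q R S) ℂ) :
        Matrix (DPIdx P Q R S) (DPIdx P Q R S) ℂ)) (X (idxQ R S q₀ r)) =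
      ∑ q' : Q, ∑ r' : R, C (star ((k.1.2 : Matrix Q Q ℂ) q' q₀) * star ((k.2.1 : Matrix R R ℂ) r' r)) *
        X (idxQ R S q' r') := by
  rw [linSubst_X, coe_dualPairι]
  simp only [idxQ, Fintype.sum_sum_type, Fintype.sum_prod_type, Matrix.star_apply, Matrix.fromBlocks_apply₁₂,
    Matrix.fromBlocks_apply₂₂, Matrix.kroneckerMap_apply, star_mul', Matrix.zero_apply, star_zero, map_zero, zero_mul,
    Finset.sum_const_zero, zero_add]

omit [IsEmpty S] in
/-- **(K-b′) THE PENCIL IMAGE OF THE RADIAL GENERATOR** (`|V⁻| = 1`): `Q ∘ ι((a,b),(c,d))⁻¹ = Σ_{p'} (a_{p'p₀} b̄_{q₀q₀}) Q_{p'}`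
— the `U(W)`-letter `c` cancels by `c c* = 1`. [folklore] -/
theorem linSubst_star_dualPairι_radQ [Subsingleton Q] (k : DPK P Q R S) (p₀ : P) (q₀ : Q) :
    linSubst (star ((dualPairι k : Matrix.unitaryGroup (DPIdx P Q R S) ℂ) :
        Matrix (DPIdx P Q R S) (DPIdx P Q R S) ℂ)) (radQ R S p₀ q₀) =
      radPencil R S q₀ (fun p' => (k.1.1 : Matrix P P ℂ) p' p₀ * star ((k.1.2 : Matrix Q Q ℂ) q₀ q₀)) := by
  have hcc : ∀ r' r'' : R, ∑ r, (k.2.1 : Matrix R R ℂ) r' r * star ((k.2.1 : Matrix R R ℂ) r'' r) =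
      if r' = r'' then 1 else 0 := by
    intro r' r''
    have h1 := Matrix.mem_unitaryGroup_iff.mp k.2.1.2
    have h2 := congrFun (congrFun h1 r') r''
    simpa only [Matrix.mul_apply, Matrix.star_apply, Matrix.one_apply] using h2
  have hsub : ∀ f : Q → MvPolynomial (DPIdx P Q R S) ℂ, ∑ q', f q' = f q₀ := fun f => Fintype.sum_subsingleton f q₀
  rw [radQ, map_sum, radPencil]
  simp only [map_mul, linSubst_star_dualPairι_X_idxP, linSubst_star_dualPairι_X_idxQ, hsub, Finset.sum_mul,
    Finset.mul_sum]
  rw [Finset.sum_comm_cycle (β := MvPolynomial (DPIdx P Q R S) ℂ) (γ := R) (α := R) (κ := P)]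
  refine Finset.sum_congr rfl fun p' _ => ?_
  rw [Finset.sum_comm_cycle (β := MvPolynomial (DPIdx P Q R S) ℂ) (γ := R) (α := R) (κ := R)]
  refine Finset.sum_congr rfl fun r' _ => ?_
  rw [Finset.sum_comm (β := MvPolynomial (DPIdx P Q R S) ℂ) (γ := R) (α := R)]
  have e : ∀ r'' : R, ∑ r : R, C ((k.1.1 : Matrix P P ℂ) p' p₀) * C ((k.2.1 : Matrix R R ℂ) r' r) * X (idxP R S p' r') *
      (C (star ((k.1.2 : Matrix Q Q ℂ) q₀ q₀)) * C (star ((k.2.1 : Matrix R R ℂ) r'' r)) * X (idxQ R S q₀ r'')) =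
      C ((k.1.1 : Matrix P P ℂ) p' p₀) * C (star ((k.1.2 : Matrix Q Q ℂ) q₀ q₀)) * (X (idxP R S p' r') * X (idxQ R S q₀ r'')) *
        C (∑ r, (k.2.1 : Matrix R R ℂ) r' r * star ((k.2.1 : Matrix R R ℂ) r'' r)) := fun r'' => by
    rw [map_sum, Finset.mul_sum]
    refine Finset.sum_congr rfl fun r _ => ?_
    rw [map_mul]
    ring
  simp only [e, hcc, apply_ite C, map_one, map_zero, mul_ite, mul_one, mul_zero, Finset.sum_ite_eq, Finset.mem_univ,
    if_true]

omit [IsEmpty S] in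
/-- hence `⟪Q^M, (Q ∘ ι(k)⁻¹)^N⟫_𝓕 = δ_{MN} (a_{p₀p₀} b̄_{q₀q₀})^N w_N`. [cite: Folland1989, Thm (1.63)] -/
theorem inner_fockToL2_radQ_pow_linSubst_radQ_pow [Subsingleton Q] (k : DPK P Q R S) (p₀ : P) (q₀ : Q) (M N : ℕ) :
    ⟪fockToL2 (radQ R S p₀ q₀ ^ M),
        fockToL2 (linSubst (star ((dualPairι k : Matrix.unitaryGroup (DPIdx P Q R S) ℂ) :
          Matrix (DPIdx P Q R S) (DPIdx P Q R S) ℂ)) (radQ R S p₀ q₀ ^ N))⟫_ℂ =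
      if M = N then ((k.1.1 : Matrix P P ℂ) p₀ p₀ * star ((k.1.2 : Matrix Q Q ℂ) q₀ q₀)) ^ N *
        ((radW (Fintype.card R) N : ℝ) : ℂ) else 0 := by
  simp only [map_pow, linSubst_star_dualPairι_radQ, inner_fockToL2_radQ_pow_radPencil_pow]

/-! ## §10  (K-c′) The vacuum overlap along the block datum is a negative-binomial series -/

omit [IsEmpty S] in
/-- `⟪e_M, μ₀(ι k) e_N⟫ = δ_{MN} (a_{p₀p₀} b̄_{q₀q₀})^N`. [cite: Folland1989, Thm (1.63), Prop (4.39)] -/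
theorem inner_radOn_schrodingerU_radOn [Nonempty R] [Subsingleton Q] (k : DPK P Q R S) (p₀ : P) (q₀ : Q) (M N : ℕ) :
    ⟪radOn R S p₀ q₀ M, schrodingerU (dualPairι k) (radOn R S p₀ q₀ N)⟫_ℂ =
      if M = N then ((k.1.1 : Matrix P P ℂ) p₀ p₀ * star ((k.1.2 : Matrix Q Q ℂ) q₀ q₀)) ^ N else 0 := by
  have hm : 0 < Fintype.card R := Fintype.card_pos
  rw [radOn, radOn, LinearIsometryEquiv.map_smul, inner_smul_left (E := L2R (DPIdx P Q R S)),
    inner_smul_right (E := L2R (DPIdx P Q R S)), radVec, radVec, ← toL2_unitaryOpPi, unitaryOpPi_binvPi, toL2_binvPi,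
    toL2_binvPi, LinearIsometryEquiv.inner_map_map, inner_fockToL2_radQ_pow_linSubst_radQ_pow, map_inv₀,
    Complex.conj_ofReal]
  split_ifs with h
  · subst h
    have hw := radW_pos hm M
    rw [mul_comm (_ ^ M), ← mul_assoc, ← mul_assoc, ← mul_inv, ← Complex.ofReal_mul, Real.mul_self_sqrt hw.le,
      inv_mul_cancel₀ (Complex.ofReal_ne_zero.mpr hw.ne'), one_mul]
  · rw [mul_zero, mul_zero]

/-- `⟪ψ_t, μ₀(ι k) e_N⟫ = conj⟪e_N, ψ_t⟫ · (a_{p₀p₀} b̄_{q₀q₀})^N`. [cite: Folland1989, Prop (4.39), (1.82)] -/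
theorem inner_toL2_hypOp_schrodingerU_radOn [Nonempty R] [Subsingleton Q] (k : DPK P Q R S) (p₀ : P) (q₀ : Q) (N : ℕ)
    (t : ℝ) :
    ⟪toL2 (hypOp R S p₀ q₀ t (hermitePi 0 : SR (DPIdx P Q R S))), schrodingerU (dualPairι k) (radOn R S p₀ q₀ N)⟫_ℂ =
      conj ⟪radOn R S p₀ q₀ N, toL2 (hypOp R S p₀ q₀ t (hermitePi 0 : SR (DPIdx P Q R S)))⟫_ℂ *
        ((k.1.1 : Matrix P P ℂ) p₀ p₀ * star ((k.1.2 : Matrix Q Q ℂ) q₀ q₀)) ^ N := by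
  set y : L2R (DPIdx P Q R S) := schrodingerU (dualPairι k) (radOn R S p₀ q₀ N) with hy
  set ψ : L2R (DPIdx P Q R S) := toL2 (hypOp R S p₀ q₀ t (hermitePi 0 : SR (DPIdx P Q R S))) with hψ
  have h := (hasSum_inner_radOn_smul_radOn R S p₀ q₀ t).mapL (innerSL ℂ y)
  have h' : HasSum (fun M => ⟪y, ⟪radOn R S p₀ q₀ M, ψ⟫_ℂ • radOn R S p₀ q₀ M⟫_ℂ) ⟪y, ψ⟫_ℂ := h
  have e : ∀ M, ⟪y, ⟪radOn R S p₀ q₀ M, ψ⟫_ℂ • radOn R S p₀ q₀ M⟫_ℂ =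
      if M = N then ⟪radOn R S p₀ q₀ N, ψ⟫_ℂ *
        conj (((k.1.1 : Matrix P P ℂ) p₀ p₀ * star ((k.1.2 : Matrix Q Q ℂ) q₀ q₀)) ^ N) else 0 := by
    intro M
    rw [inner_smul_right (E := L2R (DPIdx P Q R S)), ← inner_conj_symm y (radOn R S p₀ q₀ M), hy,
      inner_radOn_schrodingerU_radOn]
    split_ifs with hMN
    · subst hMN
      rfl
    · rw [map_zero, mul_zero]
  simp only [e] at h'
  have hv := h'.unique (hasSum_ite_eq N _)
  rw [← inner_conj_symm, hv, map_mul, starRingEnd_self_apply]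

/-- **the radial series of the vacuum overlap**: `⟪ψ_t, μ₀(ι k) ψ_s⟫ = Σ_N C_N B_N(t) B_N(s) (a_{p₀p₀} b̄_{q₀q₀})^N`.
[cite: Folland1989, Prop (4.39), (1.82)] -/
theorem hasSum_radOverlap [Nonempty R] [Subsingleton Q] (k : DPK P Q R S) (p₀ : P) (q₀ : Q) (t s : ℝ) :
    HasSum (fun N => ((radC (Fintype.card R) N * (radB (Fintype.card R) N t * radB (Fintype.card R) N s) : ℝ) : ℂ) *
        ((k.1.1 : Matrix P P ℂ) p₀ p₀ * star ((k.1.2 : Matrix Q Q ℂ) q₀ q₀)) ^ N)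
      ⟪toL2 (hypOp R S p₀ q₀ t (hermitePi 0 : SR (DPIdx P Q R S))),
        schrodingerU (dualPairι k) (toL2 (hypOp R S p₀ q₀ s (hermitePi 0 : SR (DPIdx P Q R S))))⟫_ℂ := by
  set ψt : L2R (DPIdx P Q R S) := toL2 (hypOp R S p₀ q₀ t (hermitePi 0 : SR (DPIdx P Q R S))) with hψt
  set ψs : L2R (DPIdx P Q R S) := toL2 (hypOp R S p₀ q₀ s (hermitePi 0 : SR (DPIdx P Q R S))) with hψs
  have h := ((hasSum_inner_radOn_smul_radOn R S p₀ q₀ s).mapL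
    (((schrodingerU (dualPairι k)).toContinuousLinearEquiv : (L2R (DPIdx P Q R S)) ≃L[ℂ] L2R (DPIdx P Q R S)) :
      (L2R (DPIdx P Q R S)) →L[ℂ] L2R (DPIdx P Q R S))).mapL (innerSL ℂ ψt)
  have h' : HasSum (fun N => ⟪ψt, schrodingerU (dualPairι k) (⟪radOn R S p₀ q₀ N, ψs⟫_ℂ • radOn R S p₀ q₀ N)⟫_ℂ)
      ⟪ψt, schrodingerU (dualPairι k) ψs⟫_ℂ := h
  have e : ∀ N, ⟪ψt, schrodingerU (dualPairι k) (⟪radOn R S p₀ q₀ N, ψs⟫_ℂ • radOn R S p₀ q₀ N)⟫_ℂ =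
      ((radC (Fintype.card R) N * (radB (Fintype.card R) N t * radB (Fintype.card R) N s) : ℝ) : ℂ) *
        ((k.1.1 : Matrix P P ℂ) p₀ p₀ * star ((k.1.2 : Matrix Q Q ℂ) q₀ q₀)) ^ N := by
    intro N
    rw [LinearIsometryEquiv.map_smul, inner_smul_right (E := L2R (DPIdx P Q R S)), hψt,
      inner_toL2_hypOp_schrodingerU_radOn, ← mul_assoc, ← hψt, hψs, inner_radOn_mul_conj_inner_radOn]
  simp only [e] at h'
  exact h'

omit [IsEmpty S] in
/-- `|a_{p₀p₀} b̄_{q₀q₀}| ≤ 1`. [folklore] -/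
theorem norm_blockChar_le_one (k : DPK P Q R S) (p₀ : P) (q₀ : Q) :
    ‖(k.1.1 : Matrix P P ℂ) p₀ p₀ * star ((k.1.2 : Matrix Q Q ℂ) q₀ q₀)‖ ≤ 1 := by
  rw [norm_mul, norm_star]
  have h1 := entry_norm_bound_of_unitary k.1.1.2 p₀ p₀
  have h2 := entry_norm_bound_of_unitary k.1.2.2 q₀ q₀
  exact mul_le_one₀ h1 (norm_nonneg _) h2

/-- **(K-c′) THE VACUUM OVERLAP IS A NEGATIVE-BINOMIAL SERIES** (`m = |W|`, `|V⁻| = 1`, `W⁻ = 0`):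
`⟪hypOp t h₀, μ₀(ι k) hypOp s h₀⟫_{L²} = sech^m t sech^m s · (1 − a_{p₀p₀} b̄_{q₀q₀} tanh t tanh s)^{−m}`.
[cite: Folland1989, Prop (4.39), (1.82)] -/
theorem inner_toL2_hypOp_schrodingerU_toL2_hypOp_card [Nonempty R] [Subsingleton Q] (k : DPK P Q R S) (p₀ : P) (q₀ : Q)
    (t s : ℝ) :
    ⟪toL2 (hypOp R S p₀ q₀ t (hermitePi 0 : SR (DPIdx P Q R S))),
        schrodingerU (dualPairι k) (toL2 (hypOp R S p₀ q₀ s (hermitePi 0 : SR (DPIdx P Q R S))))⟫_ℂ =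
      (((Real.cosh t)⁻¹ ^ Fintype.card R * (Real.cosh s)⁻¹ ^ Fintype.card R : ℝ) : ℂ) *
        ((1 - (k.1.1 : Matrix P P ℂ) p₀ p₀ * star ((k.1.2 : Matrix Q Q ℂ) q₀ q₀) *
          ((Real.tanh t * Real.tanh s : ℝ) : ℂ))⁻¹) ^ Fintype.card R := by
  obtain ⟨j, hj⟩ := Nat.exists_eq_succ_of_ne_zero (Fintype.card_pos (α := R)).ne'
  set χ : ℂ := (k.1.1 : Matrix P P ℂ) p₀ p₀ * star ((k.1.2 : Matrix Q Q ℂ) q₀ q₀) with hχ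
  have h := hasSum_radOverlap R S k p₀ q₀ t s
  have hr : ‖χ * ((Real.tanh t * Real.tanh s : ℝ) : ℂ)‖ < 1 := by
    rw [norm_mul, Complex.norm_real, Real.norm_eq_abs]
    exact (mul_le_of_le_one_left (abs_nonneg _) (norm_blockChar_le_one R S k p₀ q₀)).trans_lt
      (abs_tanh_mul_tanh_lt_one t s)
  have hg := (hasSum_choose_mul_geometric_of_norm_lt_one j hr).mul_left
    (((Real.cosh t)⁻¹ ^ Fintype.card R * (Real.cosh s)⁻¹ ^ Fintype.card R : ℝ) : ℂ)
  rw [hj, Nat.succ_eq_add_one] at h hg ⊢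
  rw [one_div, ← inv_pow] at hg
  refine h.unique ?_
  have e : (fun N : ℕ => ((radC (j + 1) N * (radB (j + 1) N t * radB (j + 1) N s) : ℝ) : ℂ) * χ ^ N) =
      fun N : ℕ => (((Real.cosh t)⁻¹ ^ (j + 1) * (Real.cosh s)⁻¹ ^ (j + 1) : ℝ) : ℂ) *
        (((N + j).choose j : ℂ) * (χ * ((Real.tanh t * Real.tanh s : ℝ) : ℂ)) ^ N) := by
    funext N
    rw [radC_eq_choose, radB, radB, Real.tanh_eq_sinh_div_cosh, Real.tanh_eq_sinh_div_cosh]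
    push_cast
    ring
  rw [e]
  exact hg

/-- **(K-c′), vacuum-coefficient form**: `⟪k₀, hypOp t (μ₀(ι k) (hypOp s h₀))⟫ = sech^m t sech^m s ·
(1 + a_{p₀p₀} b̄_{q₀q₀} tanh t tanh s)^{−m}`. [cite: Folland1989, Prop (4.39), (1.82)] -/
theorem inner_vacL2_toL2_hypOp_dualPairι_hypOp_card [Nonempty R] [Subsingleton Q] (k : DPK P Q R S) (p₀ : P) (q₀ : Q)
    (t s : ℝ) :
    ⟪(vacL2 : L2R (DPIdx P Q R S)),
        toL2 (hypOp R S p₀ q₀ t (unitaryOpPi (dualPairι k) (hypOp R S p₀ q₀ s (hermitePi 0))))⟫_ℂ =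
      (((Real.cosh t)⁻¹ ^ Fintype.card R * (Real.cosh s)⁻¹ ^ Fintype.card R : ℝ) : ℂ) *
        ((1 + (k.1.1 : Matrix P P ℂ) p₀ p₀ * star ((k.1.2 : Matrix Q Q ℂ) q₀ q₀) *
          ((Real.tanh t * Real.tanh s : ℝ) : ℂ))⁻¹) ^ Fintype.card R := by
  rw [← toL2_hermitePi_zero]
  nth_rewrite 1 [← hypOp_apply_neg R S p₀ q₀ t (hermitePi 0)]
  rw [toL2_hypOp, toL2_hypOp R S p₀ q₀ t (unitaryOpPi (dualPairι k) _), LinearIsometryEquiv.inner_map_map,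
    toL2_unitaryOpPi, inner_toL2_hypOp_schrodingerU_toL2_hypOp_card R S k p₀ q₀ (-t) s, Real.cosh_neg, Real.tanh_neg]
  push_cast
  ring

section VacCoeffCard

open Literature.NumberTheory.Weil1964

/-- **(K-c′) in `vacCoeffS` currency**: `vacCoeffS (hypOp t ∘ μ₀(ι k) ∘ hypOp s) = sech^m t sech^m s ·
(1 + a_{p₀p₀} b̄_{q₀q₀} tanh t tanh s)^{−m}` (`m = |W|`). [cite: Folland1989, Prop (4.39), (1.82)] -/
theorem vacCoeffS_hypOp_comp_dualPairι_comp_hypOp_card [Nonempty R] [Subsingleton Q] (k : DPK P Q R S) (p₀ : P)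
    (q₀ : Q) (t s : ℝ) :
    vacCoeffS ((hypOp R S p₀ q₀ t).comp ((unitaryOpPi (dualPairι k)).comp (hypOp R S p₀ q₀ s))) =
      (((Real.cosh t)⁻¹ ^ Fintype.card R * (Real.cosh s)⁻¹ ^ Fintype.card R : ℝ) : ℂ) *
        ((1 + (k.1.1 : Matrix P P ℂ) p₀ p₀ * star ((k.1.2 : Matrix Q Q ℂ) q₀ q₀) *
          ((Real.tanh t * Real.tanh s : ℝ) : ℂ))⁻¹) ^ Fintype.card R :=
  inner_vacL2_toL2_hypOp_dualPairι_hypOp_card R S k p₀ q₀ t s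

/-- positivity of the prefactor `sech^m t sech^m s`. [folklore] -/
theorem sech_pow_mul_sech_pow_pos (m : ℕ) (t s : ℝ) : 0 < (Real.cosh t)⁻¹ ^ m * (Real.cosh s)⁻¹ ^ m :=
  mul_pos (pow_pos (inv_pos.mpr (Real.cosh_pos t)) m) (pow_pos (inv_pos.mpr (Real.cosh_pos s)) m)

end VacCoeffCard

end Radial

/-! ## §11  The sockets: `(★★)_{-|R|}` and the unconditional linearised Weil datum -/

section Sockets

open Literature.NumberTheory.Weil1964 Literature.Analysis.SegalBargmann
open Literature.NumberTheory.Automorphic Literature.NumberTheory.Automorphic.UnitaryGroup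
open scoped ComplexConjugate

variable {P Q : Type*} (R S : Type*) [Fintype P] [DecidableEq P] [Fintype Q] [DecidableEq Q] [Fintype R]
  [DecidableEq R] [Fintype S] [DecidableEq S]

/-- **`(★★)_{-|W|}` HOLDS ON EVERY SLOT WITH `dim V⁻ = 1`, `W⁻ = 0`**: for every nonempty finite `R`, `S = ∅`, `|Q| = 1`
and every base point `(p₀, q₀)`, `VacuumOverlapPhase R S p₀ q₀ (-(|R| : ℤ))` — from the closed form
`V(t,k,s) = sech^{|R|} t sech^{|R|} s · (1 + a(k)_{p₀p₀} b̄(k) tanh t tanh s)^{-|R|}`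
(`vacCoeffS_hypOp_comp_dualPairι_comp_hypOp_card`) through the producer socket
`vacuumOverlapPhase_neg_natCast_of_exists_pos` and `χ_eq_mul_conj`. [folklore] -/
theorem vacuumOverlapPhase_neg_card [Nonempty R] [IsEmpty S] [Subsingleton Q] (p₀ : P) (q₀ : Q) :
    VacuumOverlapPhase R S p₀ q₀ (-((Fintype.card R : ℕ) : ℤ)) :=
  vacuumOverlapPhase_neg_natCast_of_exists_pos R S p₀ q₀ (Fintype.card R) fun t s k =>
    ⟨(Real.cosh t)⁻¹ ^ Fintype.card R * (Real.cosh s)⁻¹ ^ Fintype.card R, sech_pow_mul_sech_pow_pos _ t s, by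
      rw [vacOverlap, vacCoeffS_hypOp_comp_dualPairι_comp_hypOp_card, χ_eq_mul_conj, aP, bQ, starRingEnd_apply,
        Complex.ofReal_mul (Real.tanh t)]
      simp only [mul_assoc]⟩

/-- **THE UNCONDITIONAL LINEARISED WEIL DATUM ON EVERY SLOT WITH `dim V⁻ = 1`, `W⁻ = 0`** (`U(P,Q) × U(|R|)`, `|Q| = 1`,
`S = ∅`, any nonempty finite `R`): `isArchWeilDatum_linWeil_of_isEmpty_right` with its hypothesis `hVV` DISCHARGED by
`vacuumOverlapPhase_neg_card` — a representation `ω = linWeil R S q₀ (-|R|)` of `G_∞` on `𝓢(ℝ^{DPIdx})` which is an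
archimedean Weil datum over `ι𝕎`, with vacuum character `vacScalar ⟨0, -|R|, 0, 0⟩` on `K` (the `|R| = 2` instance is
the `dim W_k = 2` slot). [folklore] -/
theorem isArchWeilDatum_linWeil_neg_card [Nonempty R] [IsEmpty S] [Subsingleton Q] (p₀ : P) (q₀ : Q) :
    ∃ ω : Representation ℂ (Ginf P Q R S) (SchwartzMap (DPIdx P Q R S → ℝ) ℂ),
      IsArchWeilDatum (ι𝕎 P Q R S) ω ∧
      (∀ k : DPK P Q R S, ω (κ P Q R S k) (hermitePi 0) = vacScalar ⟨0, -((Fintype.card R : ℕ) : ℤ), 0, 0⟩ k • hermitePi 0) ∧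
      ∀ g, ω g = linWeil R S q₀ (-((Fintype.card R : ℕ) : ℤ)) g :=
  isArchWeilDatum_linWeil_of_isEmpty_right R S p₀ q₀ (vacuumOverlapPhase_neg_card R S p₀ q₀)

end Sockets

end RealDualPair

end Literature.RepresentationTheory.KonnoKonno2007
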